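import Mathlib
import HarnessLib
import HarnessLib.Audit
import Summits.Langlands.Statement
import Literature.NumberTheory.GaloisRepresentations.SymplecticMultiplier
import Literature.NumberTheory.GaloisRepresentations.CrystallineOrdinaryShape
import Literature.NumberTheory.DiophantineGeometry.AVIsogenyTate
import Literature.NumberTheory.DiophantineGeometry.AVGaloisModule
import Literature.NumberTheory.DiophantineGeometry.AVIsogenyFlat
import HarnessLib.Audit.Status.Attr

/-!
Route: PhantomRMYoshida

DORMANT since 2026-08-24T18:59:23Z (reconciler: no traction for 7 d (last activity item-evidence-added at 2026-08-17T18:36:20Z); parked, not closed — `ledger route dormant route-Langlands-PhantomRMYoshida --off` to reactivate) — unstaffed, not closed; items shared with open routes are served there. `ledger route dormant <id> --off` reactivates.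

# Route PhantomRMYoshida — phantom real multiplication — Aschbacher-C₃ torsion is residually
Yoshida-automorphic for free; endoscopic-to-stable lifting in weight (2,2)

It suffices to show X = PhantomRMSector (a sector of conjunct (B) `GaloisToAutomorphic 4` over ℚ,
weak Satake form) together with the junction PhantomRMJunction (X → Langlands, the rest of the
summit, filed so that `closes` ends in the summit constant). X: for every odd prime p, ι : ℚ̄_p ≃ ℂ
and irreducible ρ : Γ_ℚ → GL₄(ℚ̄_p) which is (i) symplectic with similitude ε⁻¹ (cohomological
convention, BoxerEtAl2021 §2), (ii) Greenberg-ordinary of Hodge–Tate shape (0,0,1,1) and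
p-distinguished at p (BoxerEtAl2021 §7.3 "p-distinguished weight-2 ordinary", through the landed
`IsGreenbergOrdinaryOfShapeAt` / `IsResiduallyDistinguishedAt`), and (iii) RESIDUALLY OF YOSHIDA
TYPE — a.e. Frobenius polynomials of ρ are p-integral and reduce to charpoly σ̄ · charpoly σ̄' for a
pair σ̄, σ̄' : Γ_ℚ → GL₂(k) of odd, irreducible, non-conjugate representations with det σ̄ = det σ̄'
= ε̄⁻¹ (orthogonal symplectic planes) — ρ is automorphic (the automorphy clause of Literature's
`IsAutomorphicAE`, spelled out inline since the 2026-08-15 cone repair: an L-algebraic cuspidal π on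
GL₄(𝔸_ℚ) — `CuspidalAutomorphicRepData 4 ℚ hcpt`, `IsLAlgebraic` — whose Satake parameters match the
arithmetic-Frobenius polynomials of ρ at almost all places, `HasSatakeParamAt` /
`arithFrobPolyOfSatake ι q_v 1`; likewise the mod-p cyclotomic character ε̄ is spelled through
Mathlib's `modularCyclotomicCharacter` on Γ_ℚ, the definiens of `modPCyclotomicCharacterZMod ℚ p`).
Card realised: phantom-real-multiplication (its P1+P2 = crux ResiduallyYoshidaLifting, its "free
anchor" = support SerreKWAutomorphicGL2 feeding crux StableYoshidaCongruence, its P3 = support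
PhantomRMTransport, its P4-type rehearsal = support RegularWeightRehearsal). PHANTOM RM is the
source of such ρ: an abelian surface A/ℚ with End(A_ℚ̄) = ℤ whose p-torsion is 𝔽_p-irreducible with
self-adjoint commutant 𝔽_p² (Aschbacher class C₃, Sp₂(p²)-type) has H¹(A_ℚ̄, 𝔽_p) ⊗ 𝔽̄_p = σ̄ ⊕
σ̄^(p) of exactly this shape, and σ̄ is modular by Khare–Wintenberger over 𝔽_p² — the absolutely
reducible residual images that BoxerCalegariGeePilloni2025 / arXiv:2510.02756 Lemma 3 must exclude
are the ones where Serre's conjecture for GSp₄(𝔽_p) is already a theorem.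
Lean: `∀ (p : ℕ) [Fact p.Prime], p ≠ 2 → ∀ (k : Type) [Field k] [CharP k p] [IsAlgClosed k]
[TopologicalSpace k] [DiscreteTopology k] (red : Valued.integer (PadicAlgCl p) →+* k) (σ σ' :
Literature.NumberTheory.GaloisRepresentations.FramedGaloisRep ℚ k 2) (hcpt :
Literature.NumberTheory.Automorphic.isCompact_glFiniteIntegralLevel 4 ℚ) (ι : PadicAlgCl p ≃+* ℂ) (ρ
: Literature.NumberTheory.GaloisRepresentations.FramedGaloisRep ℚ (PadicAlgCl p) 4), let εb :
Field.absoluteGaloisGroup ℚ →* (ZMod p)ˣ := (modularCyclotomicCharacter (AlgebraicClosure ℚ)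
(HasEnoughRootsOfUnity.natCard_rootsOfUnity (AlgebraicClosure ℚ) p)).comp
(MulSemiringAction.toRingAut (Field.absoluteGaloisGroup ℚ) (AlgebraicClosure ℚ)); σ.IsOdd → σ'.IsOdd
→ σ.toGaloisRep.IsIrreducible → σ'.toGaloisRep.IsIrreducible → (∀ g,
Literature.NumberTheory.GaloisRepresentations.FramedRep.det σ g = (Units.map (ZMod.castHom (dvd_refl
p) k).toMonoidHom (εb g))⁻¹ ∧ Literature.NumberTheory.GaloisRepresentations.FramedRep.det σ' g =
Literature.NumberTheory.GaloisRepresentations.FramedRep.det σ g) → (¬ ∃ g : GL (Fin 2) k, ∀ x, g * σ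
x * g⁻¹ = σ' x) → ρ.toGaloisRep.IsIrreducible → (ρ.IsSymplecticWithMultiplierFun (fun g =>
algebraMap ℚ_[p] (PadicAlgCl p)
((((Literature.NumberTheory.GaloisRepresentations.GaloisRep.cyclotomicCharacter ℚ p g)⁻¹ : ℤ_[p]ˣ) :
ℤ_[p]) : ℚ_[p])) ∧ (∀ v : IsDedekindDomain.HeightOneSpectrum (NumberField.RingOfIntegers ℚ), ((p :
ℕ) : NumberField.RingOfIntegers ℚ) ∈ v.asIdeal → ρ.IsGreenbergOrdinaryOfShapeAt v ![0, 0, 1, 1] ∧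
ρ.IsResiduallyDistinguishedAt v ![0, 0, 1, 1]) ∧ (∀ᶠ v : IsDedekindDomain.HeightOneSpectrum
(NumberField.RingOfIntegers ℚ) in Filter.cofinite, ρ.IsUnramifiedAt v ∧ σ.IsUnramifiedAt v ∧
σ'.IsUnramifiedAt v ∧ ∃ (P : Polynomial (Valued.integer (PadicAlgCl p))) (P₁ P₂ : Polynomial k),
ρ.HasFrobCharpolyAt v (P.map (Valued.integer (PadicAlgCl p)).subtype) ∧ σ.HasFrobCharpolyAt v P₁ ∧
σ'.HasFrobCharpolyAt v P₂ ∧ P.map red = P₁ * P₂)) → ∃ π :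
Literature.NumberTheory.Automorphic.CuspidalAutomorphicRepData 4 ℚ hcpt, π.1.IsLAlgebraic ∧ ∀ᶠ v :
IsDedekindDomain.HeightOneSpectrum (NumberField.RingOfIntegers ℚ) in Filter.cofinite, ∃ a : Multiset
ℂ, π.1.HasSatakeParamAt v a ∧ ρ.IsUnramifiedAt v ∧ ρ.HasFrobCharpolyAt v
(Literature.NumberTheory.Automorphic.arithFrobPolyOfSatake ι v.residueCard 1 a)`

## Assembly Pure logic (term-mode `closes` in glue.lean, rc 0 with Sketch.lean): fix the data and
hypotheses of PhantomRMSector; SerreKWAutomorphicGL2 applied to σ̄ and to σ̄' (odd, irreducible)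
yields the GL₂-automorphy hypotheses of StableYoshidaCongruence; the sector's own ρ witnesses its "∃
ρ of shape Sh" hypothesis, so it returns an irreducible automorphic ρ₀ of the same shape and
residual pair; ResiduallyYoshidaLifting transfers automorphy from ρ₀ to ρ; PhantomRMJunction carries
X to Langlands. Every hypothesis is passed on syntactically (the `let Sh` abbreviations zeta-reduce
to the target's clauses); no cone fact is consumed by the glue. PhantomRMTransport and
RegularWeightRehearsal are support outside the implication chain. PhantomRMJunction and Assembly are
written `∀ _ : A, B` — definitionally `A → B` — only so that, re-issued at the cone repair, they
print after the restated decls they name; `closes` is byte-identical to rev 0.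

Rationale: WHY THIS LINE. Mechanism (card phantom-real-multiplication, graded new-combination): residual
automorphy is FREE on the Aschbacher-C₃ class — σ̄ is odd and irreducible, so KhareWintenberger2009
(+ Deligne/Carayol, in the summit's L-algebraic dictionary: support SerreKWAutomorphicGL2) makes
ρ̄^ss = σ̄ ⊕ σ̄' the reduction of the endoscopic (Yoshida) transfer of a pair of weight-2 cusp
forms; modularity of ρ is then a LIFTING problem from a residually ENDOSCOPIC point to a STABLE one
in the irregular weight (2,2): crux StableYoshidaCongruence (a stable weight-2 ordinary Siegel
eigenform congruent to the Yoshida eigensystem, auxiliary level allowed: level-raising à la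
Sorensen2006/Sorensen2009 across the endoscopic/stable divide, or congruence-ideal divisibility
BochererDummiganSchulzePillot2012 / HsiehPalvannan2025) and crux ResiduallyYoshidaLifting (relative
automorphy lifting at a Yoshida-congruent maximal ideal in weight (2,2): Thorne2014 /
AllenNewtonThorne2020 reducibility-ideal patching or the Taylor–Wiles-free BergerKlosin2012 §10
principality method, run on the BoxerEtAl2021 / BoxerCalegariGeePilloni2025 higher-Hida 2-term
complexes with Calegari–Geraghty patching, ℓ₀ = 1, then weight-2 classicality). Imported areas:
finite group theory (Aschbacher's maximal-subgroup classes of GSp₄(𝔽_p) organise residual images;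
doi:10.1007/BF01388470), Hida/Iwasawa theory of Yoshida congruences (the Yoshida locus of the GSp₄
ordinary family, its congruence ideal = Rankin–Selberg p-adic L / Selmer), coherent cohomology of
the Siegel threefold. What it does that the retired gen-1 route (route-Langlands-PhantomRM,
not-a-thesis) did not: `closes` ends in `Langlands`; the p-adic condition is the semistable
GREENBERG shape with zeros on inertia (refuter note on stmt-Langlands-3647: the Borel shape admitted
non-de-Rham ρ), typed through landed Literature definitions in BCGP's cohomological convention; KW
enters fact-free, typed automorphically on GL₂; negatives index (1 entry, K3 Kuga–Satake anchor)
untouched. JUDGE REPAIR 2026-08-16 (unit rrepair-…-jud-df941cc0): both halves of the judge's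
what-would-move-it are now on the ledger as planner evidence + items — (a) the CODIMENSION
COMPUTATION (CODIM.md on the route and on crux 2: the reducible locus has codimension 0, but ρ̄ is
GSp₄-Schur, the endoscopic anchor is free and the TW/CG numerics equal the irreducible case; new
provable-now support item YoshidaResidualSp4Schur = its kernel in Lean), and (b) ONE WEIGHT-(2,2)
ENDOSCOPIC-TO-STABLE CONGRUENCE PRODUCED (ONEPAIR.md on the route and on crux 3: the pair (f_11a,
f_11a⊗χ₅) mod 3 against the stable cuspidal automorphic induction of the Rubin–Silverberg curve
ℰ_{81√5}/ℚ(√5), 3-congruent to 11a1, good ordinary and 3-distinguished at 3 —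
FreitasLeHungSiksek2015 + ArthurClozelAMS120; exact numerics attached, PARI j015205/j015221).

RANKED CRUXES. #0 PhantomRMSector (target) — X as in § Thesis: p odd; σ̄, σ̄' : Γ_ℚ → GL₂(k) (k
algebraically closed of characteristic p, reduction map red : 𝒪_ℚ̄_p → k) odd, irreducible, det
ε̄⁻¹, non-conjugate; ρ : Γ_ℚ → GL₄(ℚ̄_p) irreducible, symplectic with similitude ε⁻¹,
Greenberg-ordinary of shape (0,0,1,1) and residually distinguished at p, a.e. Frobenius polynomial ≡
charpoly σ̄ · charpoly σ̄' — then ρ is automorphic (the `IsAutomorphicAE` clause, inlined: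
L-algebraic cuspidal π on GL₄(𝔸_ℚ), Satake–Frobenius matching a.e.). Oddness is deliberately
redundant (follows from det ε̄⁻¹, p odd) so that the glue is syntactic. (why it might fail: False
only if (B) fails for an odd symplectic weight-2 ρ over ℚ; unreachable-though-true if cruxes 2–3
have no engine at the endoscopic point (no Steinberg place for abelian surfaces, N²=0; weight-(2,2)
classicality at Yoshida-congruent 𝔪; p = 3 images in GL₂(𝔽₉)).) [BoxerEtAl2021,
BoxerCalegariGeePilloni2025, arXiv:2510.02756, Thorne2014, AllenNewtonThorne2020,
KhareWintenberger2009, BergerKlosin2012] #2 ResiduallyYoshidaLifting (crux) — RELATIVE AUTOMORPHY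
LIFTING AT A RESIDUALLY-YOSHIDA POINT IN WEIGHT (2,2) (card P1+P2): p odd; σ̄, σ̄' odd irreducible
non-conjugate with det ε̄⁻¹; ρ₀, ρ : Γ_ℚ → GL₄(ℚ̄_p) both irreducible, symplectic-ε⁻¹,
Greenberg-ordinary (0,0,1,1) and p-distinguished, both residually σ̄ ⊕ σ̄' through the same red; if
ρ₀ is automorphic then ρ is automorphic. Engines: (E1) Thorne2014/AllenNewtonThorne2020
connectedness-dimension patching with reducibility ideals, transplanted from ordinary U(n)/CM to
GSp₄/ℚ on the BoxerEtAl2021 higher-Hida complexes (Calegari–Geraghty, ℓ₀ = 1), the reducible locus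
controlled through the KNOWN GL₂ Hida theory of the constituents instead of a Steinberg place —
AFTER CODIM.md (2026-08-16) read as (E1′): patch AT the endoscopic 𝔪 and prove R^ord_𝔪 = 𝕋^ord_𝔪
with the endoscopic components KEPT on both sides (they are cuspidal on GSp₄; ρ̄ is GSp₄-Schur,
h⁰(𝔰𝔭₄(ρ̄)) = 0, so R^univ exists, R ↠ 𝕋_𝔪 by universality and h⁰(ad⁰) = h⁰(ad⁰(1)) = 0 exactly as
for irreducible ρ̄), the one new deformation-theoretic ingredient being LAGRANGIAN-ISOTYPIC
Taylor–Wiles primes (q ≡ 1 (p^n), charpoly σ̄(Frob_q) = charpoly σ̄′(Frob_q) separable; Siegel-Levi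
local condition, one diamond variable each) for the cross-term dual Selmer H¹(Hom(σ̄′,σ̄)(1)), which
regular TW primes provably never touch; smallness of R^red à la Thorne2014 is NOT available
(codimension 0) and not needed; (E2) BergerKlosin2012 §10 (principality of the reducibility ideal,
R/I ≅ 𝒪/ϖ^s from the Yoshida congruence module, no Taylor–Wiles primes), moved from Siegel weight
k/2+1 ≥ 3 to weight 2 along the ordinary family; then BoxerCalegariGeePilloni2025-type classicality
of the ordinary weight-2 eigensystem and GSp₄ → GL₄ transfer (GeeTaibi2019). [deps:
StableYoshidaCongruence] [difficulty: open-problem] (why it might fail: CODIM.md: reducible locus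
has codim 0 in the ordinary family, so Thorne/ANT smallness (Steinberg place) is dead at minimal
level; live engine = patching at the endoscopic 𝔪 (ρ̄ GSp₄-Schur): needs Lagrangian-isotypic TW
primes + wt-2 classicality at endoscopic 𝔪, not in print; BK2012: cyclic Selmer.) [Thorne2014,
AllenNewtonThorne2020, Thorne2012, BergerKlosin2012, BoxerEtAl2021, BoxerCalegariGeePilloni2025,
SkinnerWiles1999, CalegariGeraghty2017, GeeTaibi2019, Pilloni2020] #3 StableYoshidaCongruence (crux)
— A STABLE AUTOMORPHIC POINT ON THE ORDINARY WEIGHT-2 DEFORMATION SPACE OF σ̄ ⊕ σ̄' (endoscopic →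
stable congruence, auxiliary level allowed): p odd; σ̄, σ̄' irreducible, non-conjugate, det ε̄⁻¹,
each residually automorphic on GL₂ in the sense output by SerreKWAutomorphicGL2; if SOME ρ (possibly
reducible, e.g. ρ_f ⊕ ρ_f', or the sector's own ρ) is symplectic-ε⁻¹, Greenberg-ordinary (0,0,1,1),
p-distinguished with residual pair (σ̄, σ̄'), then for every ι there is an IRREDUCIBLE automorphic
ρ₀ of the same shape and residual pair — i.e. a stable weight-2 p-ordinary Siegel eigenform of some
level congruent to the Yoshida eigensystem of the pair, transferred to GL₄. Engines: weight-2
ordinary newform lifts of σ̄, σ̄' (weight part of Serre + Hida), then level-raising at auxiliary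
primes q whose Frobenius has a CROSS eigenvalue ratio q between σ̄ and σ̄' but no internal Ribet
ratio (forces the q-new form out of every Yoshida packet), on a compact-at-∞ inner form of GSp₄
(Sorensen2006) or in coherent H⁰/H¹ of the Siegel threefold; alternatively p | L_alg(f ⊗ f')
congruences (BochererDummiganSchulzePillot2012, Agarwal–Klosin, HsiehPalvannan2025); irreducibility
of ρ₀ from cuspidality on GL₄ + 2-dimensional Fontaine–Mazur (Kisin2009) or arXiv:2603.19768.
INSTANCE PRODUCED 2026-08-16 (ONEPAIR.md): on the TWIST sub-family σ̄′ ≅ σ̄ ⊗ χ_K, K REAL quadratic,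
the conclusion holds by Weil restriction — ρ₀ = H¹(Res_{K/ℚ} E) = Ind H¹(E) for E/K p-congruent to
σ̄ (Rubin–Silverberg genus-0 families, p ∈ {3, 5}) and not isogenous to a twist of its conjugate:
irreducible, symplectic-ε⁻¹, automorphic cuspidal on GL₄ (FreitasLeHungSiksek2015 + automorphic
induction ArthurClozelAMS120), STABLE of Arthur type (G) (parameter through N(H)∖H, Roberts2001's
twisted-Yoshida packets), residually σ̄ ⊕ σ̄χ_K on ORTHOGONAL planes (BanwaitEtAl2023 type (2b)),
and, when p is inert in K, Greenberg (0,0,1,1) + p-distinguished AUTOMATICALLY once E is ordinary at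
(p); explicitly (f_11a, f_11a⊗χ₅) mod 3 with E = ℰ_{81√5} (reduction = 11a1 mod 3, a_(3) = −5).
[deps: SerreKWAutomorphicGL2] [difficulty: open-problem] (why it might fail: Instance exhibited only
for twist pairs σ̄′≅σ̄⊗χ_K, K real quadratic (Weil restriction of a 3-congruent E/K: ONEPAIR.md,
FLS2015); for generic/phantom-RM pairs no wt-(2,2) endoscopic→stable congruence in print (BDSP2012
§9 needs k′−k≥6; Sorensen regular wt); cross-ratio primes can fail at p=3.) [Sorensen2006,
Sorensen2009, LemmaOchiai2023, BochererDummiganSchulzePillot2012, HsiehPalvannan2025,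
FreitasLeHungSiksek2015, RubinSilverberg1995, BanwaitEtAl2023, ArthurClozelAMS120, Roberts2001,
BergerKlosin2012, arXiv:2603.19768] #9 SerreKWAutomorphicGL2 (crux of rank 9 since the gate's
AUTO-CRUX pass of 2026-08-16, confirmed at the badge repair: refuter crux-attack SURVIVES and
cdisprove finds no kill — a theorem in print whose one failure mode is the typed
newform→CuspidalAutomorphicRepData dictionary, XL and unbuilt) — NAMED-FACT GATE, typed fact-free
(first hypothesis of `closes`): Serre's conjecture (Khare–Wintenberger–Kisin) in the summit's
automorphic L-normalisation — for every prime p, k algebraically closed of characteristic p, red :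
𝒪_ℚ̄_p → k and every odd irreducible σ̄ : Γ_ℚ → GL₂(k), and every ι, there is an L-algebraic
cuspidal π₂ of GL₂(𝔸_ℚ) whose Satake polynomials ∏(X − ι⁻¹(a_j⁻¹)) at almost all v are p-integral
and reduce through red to charpoly σ̄(Frob_v) (π₂ = π_f ⊗ |det|^((k−1)/2) up to a finite
twist/Galois conjugation, f the KW newform). Theorem in print: KhareWintenberger2009 Thm 1.2/9.1 +
Kisin2009TwoAdic + Deligne/Carayol + BuzzardGeeLMS2014 §3; in the tree the Galois-side weak form is
the named fact `Literature.NumberTheory.Automorphic.exists_newform_of_odd_irreducible` (lang.S37),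
deliberately NOT referenced so that no unproved Literature Prop enters the cone; the residual risk
is the classical→adelic dictionary and the sign of the half-twist. [difficulty: XL]
[KhareWintenberger2009, KhareWintenberger2009II, Kisin2009TwoAdic, Carayol1986, BuzzardGeeLMS2014,
Gelbart1975] #9 SectorGlue (support; glue, provable now) — SerreKWAutomorphicGL2 →
StableYoshidaCongruence → ResiduallyYoshidaLifting → PhantomRMSector: the three cruxes imply the
target sector by the pure-logic term already inlined in `closes` (SerreKWAutomorphicGL2 at σ̄ and
σ̄' discharges the GL₂-automorphy hypotheses of StableYoshidaCongruence, the sector's own ρ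
witnesses its shape hypothesis, the irreducible automorphic ρ₀ it returns feeds
ResiduallyYoshidaLifting); added 2026-08-16 at the badge repair so that an ITEM concludes the target
(stamp route.target-unreachable); composed with PhantomRMJunction it is the Assembly item; planner
Sketch.lean rc 0, axioms propext/Classical.choice/Quot.sound. [difficulty: provable-now] #9
PhantomRMJunction (support) — the rest of the summit: PhantomRMSector → Langlands (upgrade a.e.
matching to Corresponds by local–global compatibility and strong multiplicity one; direction (A);
all other n, F, weights, residual classes). Not this route's business; true iff Langlands; filed so
that `closes` ends in the summit constant; shared junction for every GSp₄/abelian-surface card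
stated through PhantomRMSector. [difficulty: open-problem] [BuzzardGeeLMS2014,
FontaineMazurGeometric1995, ArthurClozelAMS120] #9 PhantomRMTransport (support) — THE TRANSPORT
LEMMA (card P3; linear algebra + Clifford theory, provable now), cohomological convention: p odd, k
algebraically closed of characteristic p; ρ̄ : Γ_ℚ → GL₄(𝔽_p) continuous, IRREDUCIBLE, preserving an
alternating non-degenerate J with multiplier ε̄⁻¹, whose commutant is exactly 𝔽_p[Φ] ≅ 𝔽_p² (Φ² = aΦ
+ b, X² − aX − b irreducible) with Φ J-self-adjoint (Φᵀ J = J Φ: Sp₂(p²)-type of Aschbacher class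
C₃, not the GU₂(p)-type). Then ρ̄ ⊗ k is conjugate to the block-diagonal σ ⊕ σ^(p) with σ : Γ_ℚ →
GL₂(k) odd, irreducible, det σ = ε̄⁻¹ and σ not conjugate to σ^(p). Proof sketch: the eigenplanes W,
W' of Φ ⊗ k (eigenvalues λ ≠ λ^p) are Γ-stable; Φ* = Φ gives (λ − λ^p)⟨W, W'⟩ = 0, so each plane is
J-non-degenerate, det σ = multiplier, σ odd; irreducibility of ρ̄ + End = 𝔽_p² give absolute
irreducibility of V over 𝔽_p², hence of σ = V ⊗ k, and σ ≇ σ^(p) (else End ⊗ k would be M₂(k), of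
dimension 4 ≠ 2). [difficulty: M] [doi:10.1007/BF01388470, KhareWintenberger2009,
BoxerCalegariGeePilloni2025] #9 RegularWeightRehearsal (support) — REGULAR-WEIGHT DRESS REHEARSAL of
crux 2 (scalar Siegel weight 3: Hodge–Tate shape (0,1,2,3), similitude ε⁻³, residual pair with det
ε̄⁻³, e.g. ρ̄_g ⊕ ρ̄_f ε̄⁻¹ for g ∈ S₄, f ∈ S₂): the same relative lifting statement with the
regular Greenberg shape (0,1,2,3). Expected to follow, for p ≥ 7 and σ̄|, σ̄'| on Γ_ℚ(ζ_p)
absolutely irreducible, from AllenNewtonThorne2020 Thm 1.1 over an imaginary quadratic K in which p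
splits (ρ|Γ_K is conjugate self-dual up to twist, ordinary of regular weight, residually
multiplicity-free) modulo its locally-Steinberg hypothesis, plus cyclic base change/descent
(ArthurClozelAMS120) and GSp₄ ↔ GL₄ (GeeTaibi2019); BergerKlosin2012 §10 Thm 77 is its fixed-level
conditional form. Closing it (even modulo named facts) certifies the Galois-theoretic half of crux 2
before the irregular weight is attempted and isolates exactly what the Steinberg hypothesis costs.
[difficulty: L] [AllenNewtonThorne2020, Thorne2014, BergerKlosin2012, ArthurClozelAMS120,
GeeTaibi2019] #9 YoshidaResidualSp4Schur (support; provable now, added 2026-08-16 at the judge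
repair) — THE GSp₄-SCHUR PROPERTY OF THE YOSHIDA RESIDUAL TYPE (kernel of CODIM.md §2): p odd, k
algebraically closed of characteristic p; σ̄, σ̄′ : Γ_ℚ → GL₂(k) irreducible and non-conjugate; then
every X ∈ 𝔰𝔭₄(k) (XᵀJ + JX = 0, J = J₂ ⊕ J₂ the orthogonal-sum form) commuting with the
block-diagonal σ̄ ⊕ σ̄′ vanishes — H⁰(Γ_ℚ, 𝔰𝔭₄(ρ̄)) = 0 although ρ̄ is reducible. Proof: Schur kills
the off-diagonal blocks (non-conjugate) and makes the diagonal blocks scalars a, d; XᵀJ + JX = 2aJ₂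
⊕ 2dJ₂ = 0 gives a = d = 0. It is what makes the universal GSp₄-deformation ring of ρ̄ exist and the
TW/CG numerics of crux 2 equal the irreducible case; typed with Matrix.fromBlocks over Fin 2 ⊕ Fin 2
(planner Sketch.lean rc 0). [difficulty: S] [doi:10.1007/BF01388470, Thorne2012, BoxerEtAl2021] #9
OnePairCertificate (support, informal [computation], added 2026-08-16) — extend ONEPAIR.md §2 into a
full certificate of the produced congruence: conductor ideal 𝔣 of ℰ_{81√5}/ℚ(√5) and the paramodular
level 25·N(𝔣) of A = Res ℰ (PARI j015221), the first 50 good Hecke eigenvalues λ_ℓ(F_A) = tr Ind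
H¹(ℰ)(Frob_ℓ) against a_ℓ(11a)(1 + χ₅(ℓ)) mod 3, the analogous p = 5 instance (Rubin–Silverberg
mod-5 family, K real quadratic with 5 inert), and — census link — the list of
BoxerCalegariGeePilloni2025-modular LMFDB genus-2 curves (11743) whose mod-ℓ image for some odd good
ordinary ℓ is of self-dual 2+2 type (BanwaitEtAl2023 Algorithm 3.10), each of which is a
weight-(2,2) endoscopic-to-stable congruence for a NON-twist pair. [difficulty: provable-now]
[RubinSilverberg1995, FreitasLeHungSiksek2015, BanwaitEtAl2023, BoxerCalegariGeePilloni2025]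

TWO-LAYER PLAN. Foreseen glued splits (filed only after a crux closes or a census asks):
ResiduallyYoshidaLifting ⇐ (L1) Λ-adic R^ord = T^ord for GSp₄/ℚ at the Yoshida-congruent maximal
ideal in REGULAR weights, ENDOSCOPIC COMPONENTS INCLUDED (classical Galois representations and
classicality; the reducible locus — codimension 0, CODIM.md — is the union of Λ-adic Yoshida
families = pairs from the two KNOWN GL₂ Hida families with matched determinant, present in 𝕋 via the
everywhere-generic member of the endoscopic packet; TW primes: regular for ad⁰σ̄(1) ⊕ ad⁰σ̄′(1),
Lagrangian-isotypic for Hom(σ̄′,σ̄)(1)) → (L2) weight-(2,2) specialisation +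
classicality/multiplicity one of the ordinary eigensystem at an endoscopic-congruent 𝔪
(BoxerEtAl2021 §4–7, BoxerCalegariGeePilloni2025, Pilloni2020) → ResiduallyYoshidaLifting.
StableYoshidaCongruence ⇐ (S1) Chebotarev supply of cross-ratio level-raising primes in im(σ̄ × σ̄'
× ε̄) → (S2) GSp₄ Ribet lemma endoscopic → stable at one such q preserving p-ordinarity and
similitude (Sorensen2006 on a compact inner form, or coherent H⁰/H¹) → StableYoshidaCongruence.
Alternative family for S2 (separate route if pursued): the Diophantine engine — a BCGP-modular
genus-2 Jacobian with big image at 3 and prescribed mod-p semisimplification.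

KILL CRITERIA. (i) A residually-Yoshida, Greenberg-ordinary p-distinguished symplectic ρ over ℚ that
is provably NOT automorphic refutes PhantomRMSector and (B) itself — not expected. Realistic kills
are structural: (ii) [dimension half COMPUTED 2026-08-16, CODIM.md: the reducible locus has
codimension 0 — and this does NOT kill, because the endoscopic components are cuspidal on GSp₄ and
ρ̄ is GSp₄-Schur; the criterion is therefore RESTATED] a proof that the everywhere-generic member of
the endoscopic packet Π(f₁ ⊠ f₂) does not contribute to the patched weight-2 ordinary complex at 𝔪
(no free anchor: 𝕋_𝔪 could vanish) OR that Lagrangian-isotypic Taylor–Wiles primes cannot be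
supplied/controlled for σ̄ ⊕ σ̄′ (no TW system kills H¹(Hom(σ̄′,σ̄)(1))), AND the Berger–Klosin
congruence-module route fails for non-cyclic Selmer — then crux 2 has no engine: close `exhausted`
with census or pivot to the p | L_alg(f ⊗ f')-exactly-once sub-sector; (iii) a proof that endoscopic
→ stable level-raising is obstructed for Yoshida packets at every auxiliary prime
(sign/epsilon-factor obstruction in the global packet) refutes the mechanism of crux 3 for GENERIC
pairs [as a blanket statement it is now FALSE: weight-(2,2) residually-Yoshida stable points exist,
ONEPAIR.md] — pivot to the Diophantine engine or close `refuted:StableYoshidaCongruence` if the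
statement itself falls; (iv) SerreKWAutomorphicGL2 refuted as TYPED (normalisation) is `misstated`:
repair by restating the half-twist, route survives. A proof elsewhere of Serre's conjecture for
GSp₄(𝔽_p) plus BCGP-type lifting for all residual images moots the route (arXiv:2510.02756 Lemma 3).

NOT DECOMPOSED YET. The glue "cruxes 2–3 at the level of Hecke algebras" needs GSp₄ automorphic
objects the tree lacks (Siegel threefold coherent cohomology, Hida families for GSp₄, Yoshida/theta
packets Roberts2001, Galois representations of weight-2 Siegel forms Taylor1991/Mok2014, transfer
GeeTaibi2019) — all live inside proofs as cited named facts, requested when a skeleton needs them.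
Not items: the p = 3 small-image sub-cases (σ̄(Γ_ℚ) ⊂ GL₂(𝔽₉) soluble), twist-equivalent pairs σ̄' ≅
σ̄ ⊗ χ (since 2026-08-16 the EVEN-χ ones carry the produced instance of crux 3 by Weil restriction,
ONEPAIR.md, but stay un-itemised), the Lagrangian-isotypic TW-prime supply and its GL₂ × GL₁-Levi
local condition (engine-internal supports of crux 2, CODIM.md §4), the GU₂(p)-type (isotropic,
Siegel-parabolic) residual images (other mechanism: card siegel-eisenstein-fern), totally real base
fields, and the census computation (filed informal after open).

CHEAPEST FALSIFIER. (1) DONE 2026-08-16 (CODIM.md, attached to the route and to crux 2): the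
Greenberg–Wiles count for ρ̄ = σ̄ ⊕ σ̄′ on GSp₄/ℚ. 𝔤𝔰𝔭₄(ρ̄) = 𝔷 ⊕ ad⁰σ̄ ⊕ ad⁰σ̄′ ⊕ Hom(σ̄′,σ̄)
(1+3+3+4; a single cross term because det σ̄ = det σ̄′), h⁰(𝔰𝔭₄(ρ̄)) = 0, h⁰(𝔰𝔭₄(ρ̄)(1)) = 0 (p ≥
5), −h⁰(ℝ) = −4, p-term 6 / 4 / 3 for Borel-Λ / Borel-fixed-weight / Siegel-(2,2): expected relative
dimensions 2 / 0 / −1 — IDENTICAL to the irreducible case; reducible locus = pairs from the two GL₂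
ordinary families (dim 2 each) with det σ = det σ′ (one equation): 2 + 2 − 1 = 3 free-similitude =
full dimension, CODIMENSION 0 (Λ-adic Yoshida components; every symplectic ρ̄ with this
semisimplification is split, so no Skinner–Wiles extension-class divisor; N² = 0 leaves no excluding
local condition). ANSWER to the question as posed: NO, the reducible locus does not acquire
codimension ≥ 2 (nor 1) without a Steinberg place — and crux 2 is nevertheless NOT engine-less,
because on GSp₄ the reducible components are honest cuspidal (endoscopic) components of 𝕋_𝔪: the
target becomes R_𝔪 = 𝕋_𝔪 with endoscopic components kept, the anchor is free, and the new
requirement is Lagrangian-isotypic Taylor–Wiles primes (regular ones have killing capacity 0 on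
H¹(Hom(σ̄′,σ̄)(1))). (1b) DONE 2026-08-16 (ONEPAIR.md): one weight-(2,2) endoscopic-to-stable
congruence PRODUCED — (f_11a, f_11a⊗χ₅) mod 3 against the stable cuspidal automorphic induction of
ℰ_{81√5}/ℚ(√5) (Rubin–Silverberg mod-3 family of 11a1; exact check: good ordinary at the inert (3),
a_(3) = −5, Ind irreducible via a_𝔭 ≠ ±a_𝔭σ at 71, 79, 89, 101, 109); the cheapest remaining check
of this kind is the NON-twist census of (2). (2) Census (kit/LMFDB, filed as an informal support
item): genus-2 curves over ℚ with End = ℤ, good ordinary reduction at p ∈ {3,5}, mod-p image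
𝔽_p-irreducible but absolutely reducible; split Sp₂(p²)- vs GU₂(p)-type; confirm σ̄ matches a
weight-2 newform mod λ with residue field 𝔽_p² (a mismatch refutes PhantomRMTransport's typing, not
KW); look for a congruent STABLE paramodular/Siegel eigenform of small level (evidence for crux 3).
(3) Lookup done this session: HsiehPalvannan2025 rigidity is at FIXED tame level under Bloch–Kato
finiteness — it does not contradict crux 3, which allows auxiliary level; AllenNewtonThorne2020 Thm
1.1 (read) confirms the locally-Steinberg hypothesis is load-bearing there.

NUMBERS. Items at open: 8 typed (1 target, 2 cruxes, 4 support, 1 assembly) + 1 informal support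
(census). After the 2026-08-16 badge repair: 10 typed (1 target; 3 cruxes = ResiduallyYoshidaLifting
r2, StableYoshidaCongruence r3, SerreKWAutomorphicGL2 r9 auto-crux; 5 support incl. the glue
SectorGlue; 1 assembly) + 1 informal support (census); imports unchanged (2), decl-cone 0 unproved
of 314. BoxerCalegariGeePilloni2025 / arXiv:2510.02756: modularity of A/ℚ needs good ordinary
reduction at 3, ρ̄_(A,3) absolutely irreducible (surjective or in an explicit list) — every
phantom-RM surface at 3 is outside; their Lemma 3 reduces all abelian surfaces to a Serre-type
statement for ABSOLUTELY IRREDUCIBLE ρ̄. |GSp₄(𝔽₃)| = 103680 = 2·|Sp₄(𝔽₃)|; the C₃ subgroup (GL₂(𝔽₉)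
with 𝔽₃-rational determinant).2 has order 2·2·|SL₂(𝔽₉)| = 2880. AllenNewtonThorne2020 Thm 1.1: l >
3, l ∤ n, F ⊄ F⁺(ζ_l), locally Steinberg v₀. BergerKlosin2012 Thm 77: p > k ≥ 4 even, N square-free,
l ∤ N with l ≢ 1 mod p, conditional on (MC) and Conj. 76. Weight-(2,2): ℓ₀ = 1, 2-term complexes
(BoxerEtAl2021). CONE (route-repair 2026-08-15, unit rrepair-Langlands-PhantomRMYoshida-f172ac72):
imports = [Literature.NumberTheory.GaloisRepresentations.SymplecticMultiplier,
Literature.NumberTheory.GaloisRepresentations.CrystallineOrdinaryShape] on top of the gate-mandated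
Summits.Langlands.Statement. Dropped: …GaloisRepresentations.ModPGaloisRep (its closure carried
ArtinConductor.lean's holds-free `GaloisRep.natCast_localArtinConductor`, XL, audit-flagged
over-general) and …Automorphic.IsAutomorphicAE (imports ReciprocityGLnProofs.lean, whose
`HarrisLanTaylorThorne2016.theoremA_existence` / `Varma2024.corollary93_unramified` are XL and
holds-free, although IsAutomorphicAE itself uses only ReciprocityGLn vocabulary). The five items
naming those constants were restated 1:1, DEFINITIONALLY EQUAL to rev 0 (planner EquivCheck.lean:
Old ↔ New := Iff.rfl for all eight decls, lean rc 0); mock render with the trimmed imports (planner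
Sketch.lean): lean rc 0, `closes` unchanged, axioms propext / Classical.choice / Quot.sound.
Route-attributable holds-free module-cone facts 3 → 0; gate decl-cone at rev 0 already 0 unproved of
318 constants. needs-fact: NONE. The 13 remaining holds-free cite-tagged closed Props of the module
cone (IsEssentiallySelfAdjoint.isSymmetric, AdelicGroupData.IsDiscreteRational,
exists_hasInfinityType, hasSatakeParamAt_iff_L2, isAdmissibleGK_of_irreducible_unitary,
isIrreducibleGK_of_isTopIrreducible_unitary, multiplicity_cuspidal_lt_top,
isAdmissible_jacquetModule, IsDiscreteSeries.isTempered, exists_galoisRep_of_regularAlgebraic,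
potentiallyModular_ellipticCurve_CM, exists_intermediateField_normSubgroup_eq; + [folklore]
hasRSGamma_tate_compatible) enter only through Summits.Langlands.Statement →
Langlands/Statement.lean (operator-owned), are shared by every route of the summit and are
hypotheses of no item here. JUDGE REPAIR 2026-08-16: items 11 → 13 (new typed support
YoshidaResidualSp4Schur, new informal [computation] support OnePairCertificate); cruxes unchanged 3
(r2, r3, r9), closes unchanged (4 hypotheses, native OK). Instance data: E₀ = 11a1 (a₃ = 1, j =
−2¹²31³/11⁵, v₃(J−1) = −3 forces v₃(t) ≥ 4 in the Rubin–Silverberg parameter for good reduction at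
3); K = ℚ(√5), 3 inert; t = 3⁴√5: 3-integral model ≡ 11a1 (mod 3), Δ̄ = 1, #ℰ(𝔽₉) = 15, a_(3) = −5;
split Frobenius pairs (a_𝔭, a_𝔭σ): 19 (6,−6), 31 (7,7), 41 (−8,−8), 59 (−4,−4), 61 (12,12), 71
(12,−6), 79 (−10,8), 89 (−3,6), 101 (5,8), 109 (−8,4), all ≡ a_p(11a1) (mod 3); inert traces 7: 2,
13: 5, 17: 6, 23: 6 ≡ a_p² − 2p (mod 3); coarse parameters v₃(t) ≤ 1 give additive reduction at 3
(conductor exponent 3, PARI j015205). BCGP2025 Thm 1 applies to 11743 of 66158 LMFDB genus-2 curves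
(census pool for NON-twist instances at ℓ ≥ 5 via BanwaitEtAl2023 Algorithm 3.10).

DEFINITION REQUESTS. To be filed after open: (D1) `FramedGaloisRep.HasResidualPairVia red ρ σ σ'`
(Literature/NumberTheory/GaloisRepresentations): the a.e. clause "ρ, σ, σ' unramified at v and ∃ P ∈
𝒪[X], P₁, P₂ with charpoly ρ(Frob_v) = P, charpoly σ(Frob_v) = P₁, charpoly σ'(Frob_v) = P₂, P mod 𝔪
= P₁P₂" inlined four times above; (D2) `FramedGaloisRep.IsResiduallyAutomorphicGL2Via red ι σ` for
the conclusion of SerreKWAutomorphicGL2 (inlined three times). Already landed from gen-1's requests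
and USED here: `IsSymplecticWithMultiplierFun` (SymplecticMultiplier.lean),
`IsGreenbergOrdinaryOfShapeAt` / `IsResiduallyDistinguishedAt` (CrystallineOrdinaryShape.lean),
`IsAutomorphicAE`. Cite facts wanted later as hypotheses (not now): Yoshida/theta packets for GSp₄
(Roberts2001), Galois representations for weight-2 Siegel eigenforms (Taylor1991, Mok2014), GSp₄ →
GL₄ transfer (GeeTaibi2019, Arthur2013), BoxerEtAl2021 Thm 1.1.3-type ordinary lifting as a named
fact. PROVER NOTE (cone hygiene): a proved item is linked by `import …Theorems.<Name>`, so Theorems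
files for this route should import ReciprocityGLn / GaloisRep / SymplecticMultiplier /
CrystallineOrdinaryShape (and Mathlib) directly, not IsAutomorphicAE.lean or ModPGaloisRep.lean,
until a literature hygiene pass re-points IsAutomorphicAE.lean's import from ReciprocityGLnProofs to
ReciprocityGLn (it needs nothing else) and ArtinConductor's natCast_localArtinConductor is
discharged or retired; the bridge lemmas `isAutomorphicAE_iff` (Iff.rfl) and
`coe_modPCyclotomicCharacter_apply` (rfl) show nothing is lost by the inline spelling.

Novelty: Searches (2026-08-15; local searchd rc 75 all session, zbMATH + galaxy + citation graph reachable):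
`lit search --source zbmath "Yoshida lift
congruence"` (4: BochererDummiganSchulzePillot2012, HsiehPalvannan2025, Böcherer–Schulze-Pillot
1990, Okazaki 2007); `"automorphy lifting
residually reducible"` (2: Thorne2014, AllenNewtonThorne2020 — read Thm 1.1, pp. 3–5); `"level
raising GSp(4) endoscopic Yoshida lift
congruence stable"` (0); `"residually reducible Galois representations automorphy lifting
symplectic"` 2015+ (0); `"Berger Klosin deformations
Saito-Kurokawa type paramodular"` (1: BergerKlosin2020); `lit read arXiv:1103.5100 --grep Yoshida`
(BergerKlosin2012 §10 Thm 77 read);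
`"modularity abelian surfaces"` 2023+ (19: arXiv:2510.02756 Gee — read §6 Lemma 3; arXiv:2308.02708
Huang, three JH factors BK-style;
Banwait–Brumer et al. nonsurjective primes arXiv:2301.02222); `lit galaxy search "residually
reducible l-adic Galois representations" --star
all` (1 book row, Tilouine et al. eds.); `lit frontier Langlands --since 2024` (30 rows; relevant:
arXiv:2603.19768 irreducibility/monodromy
for GL(4), arXiv:1908.07073 level lowering in higher dimension); `ledger negatives --problem
Langlands` (1, unrelated); the card's and the
gen-1 route's recorded queries and seven novelty-audit passes (refuter, grade new-combination kept).
Nearest prior art found: BergerKlosin2012 (doi:10.1007/s00208-012-0793-1) §10 Thm 77 — conditional R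
= T for residually Yoshida-type 4-dim ρ
over ℚ, REG  [refs: 10.1007/s00208-012-0793-1, 1103.5100, 2510.02756, 2308.02708, 2301.02222, 2603.19768, 1908.07073, doi:10.1007/s00208-012-0793-1, BochererDummiganSchulzePillot2012, HsiehPalvannan2025, Thorne2014, AllenNewtonThorne2020, BergerKlosin2020, BergerKlosin2012, BoxerEtAl2021, BoxerCalegariGeePilloni2025]

Barriers (technique_class: taylor-wiles patching automorphy-lifting reducibility-ideal): - technique_class: taylor-wiles patching automorphy-lifting reducibility-ideal
- Literature.Barriers.Langlands.ResiduallyReducibleBarrier: ENGAGED HEAD-ON and evaded by the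
barrier's own printed evasion — ρ̄ ⊗ 𝔽̄_p is reducible but MULTIPLICITY-FREE with both constituents
odd and modular (Skinner–Wiles / Thorne2014 / AllenNewtonThorne2020 reducibility-ideal regime, or
BergerKlosin2012 principality), transplanted to GSp₄/ℚ in weight (2,2); crux 2's why-might-fail (no
Steinberg place, full-dimensional Yoshida components) is exactly the barrier's failure mode and the
cheapest falsifier tests it first.
- Literature.Barriers.Langlands.NonRegularWeightBarrier: engaged (Hodge–Tate shape (0,0,1,1), limits
of discrete series at ∞) and evaded by the COHERENT route the barrier lists — higher Hida theory /
higher coherent cohomology of the Siegel threefold and Calegari–Geraghty patching of 2-term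
complexes (BoxerEtAl2021, BoxerCalegariGeePilloni2025, Pilloni2020), imported wholesale; nothing new
is claimed about the weight.
- Literature.Barriers.Langlands.TaylorWilesNumericalCoincidence: the coincidence fails by exactly ℓ₀
= 1 for GSp₄/ℚ in weight (2,2); evaded as in Calegari–Geraghty / BCGP by patching complexes in two
degrees; the reducible residual image only changes the Taylor–Wiles-prime bookkeeping (primes
balanced between σ̄ and σ̄', Thorne2014), and engine (E2) uses no Taylor–Wiles primes at all.
- Literature.Barriers.Langlands.TaylorWilesNumericalCoincidenceNarrow: not applicabl

History (route lifecycle, newest last):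
- 2026-08-15T19:29:53Z · rev 1: restated PhantomRMSector (stmt-Langlands-12941), ResiduallyYoshidaLifting (stmt-Langlands-12942), StableYoshidaCongruence (stmt-Langlands-12943), PhantomRMTransport (stmt-Langlands-12946), RegularWeightRehearsal (stmt-Langlands-12947), PhantomRMJunction (stmt-Langlands-12945), Assembly (stmt-Langlands-12948) — r (planner-rrepair-Langlands-PhantomRMYoshida-f172ac72-0)
- 2026-08-16T02:19:15Z · AUTO-CRUX: 1 conjecture-grade item(s) promoted to crux (SerreKWAutomorphicGL2) — refuter vetting / tiering apply (operator:999:1362873)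
- 2026-08-16T07:39:38Z · rev 8: dropped stmt-Langlands-15059 — housekeeping: drop stmt-Langlands-15059, an accidental DUPLICATE of the informal [computation] support item OnePairCertificate (stmt-Langlands-15057, kept) crea (planner-rrepair-Langlands-PhantomRMYoshida-jud-df941cc0-0)
- 2026-08-16T15:00:52Z · rev 14: dropped StableYoshidaCongruenceModFaltings — route-choice (unit rchoice-Langlands-PhantomRMYoshida-Fal-db8f7805, crux stmt-Langlands-15084 FaltingsFinitenessI — verdict WAIT, hold confirmed; RCHOICE-5.md): (planner-rchoice-Langlands-PhantomRMYoshida-Fal-db8f7805-0)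
- 2026-08-24T18:59:23Z · DORMANT — reconciler: no traction for 7 d (last activity item-evidence-added at 2026-08-17T18:36:20Z); parked, not closed — `ledger route dormant route-Langlands-PhantomR (operator:999:81380)

sub-problem: Langlands · status: dormant · opened planner-plancard-Langlands-Langlands-phantom--6516ef8a-g2-0 2026-08-15T18:56:52Z · rev 14 · ledger route-Langlands-PhantomRMYoshida
GENERATED by the gate from the ledger (D-0016/17). Provers cite these decls: `theorem foo : Summit.Langlands.Langlands.Theses.PhantomRMYoshida.<Decl> := …` in Summits/Langlands/Langlands/Theorems/<Name>.lean.
-/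

namespace Summit.Langlands.Langlands.Theses.PhantomRMYoshida

open scoped BigOperators Topology Manifold Classical MeasureTheory ProbabilityTheory Matrix InnerProductSpace ComplexConjugate ContinuousMap
open Filter Set Function TopologicalSpace MeasureTheory

attribute [summit_statement] _root_.Langlands

-- earlier PhantomRMSector (stmt-Langlands-12941, replaced 2026-08-15T19:29:53Z -> stmt-Langlands-13638): retired by None — ∀ (p : ℕ) [Fact p.Prime], p ≠ 2 → ∀ (k : Type) [Field k] [CharP k p] [IsAlgClosed k] [TopologicalSpace k] [DiscreteTopology k] (red : Valued.integer (PadicAlgCl p) →+* k) (σ σ' : Literature.NumberTheory.GaloisRepresentations.FramedGaloisRep ℚ k 2) (hcpt : Literature.NumberTheory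
/-- item stmt-Langlands-13638 · target · rank 0 · open · by planner
why it might fail: False only if conjunct (B) fails for an odd symplectic weight-(2,2) ρ/ℚ; as stated it also covers twist-equivalent pairs σ̄′≅σ̄⊗χ and p=3 soluble GL₂(𝔽₉)-images no engine treats; unreachable-though-true if cruxes 2–3 have no engine at the endoscopic point (no Steinberg place, N²=0).
sources: BoxerEtAl2021, BoxerCalegariGeePilloni2025, arXiv:2510.02756, Thorne2014, AllenNewtonThorne2020, KhareWintenberger2009
[target] X as in § Thesis: p odd; σ̄, σ̄' : Γ_ℚ → GL₂(k) (k algebraically closed of characteristic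
p, reduction map red : 𝒪_ℚ̄_p → k) odd, irreducible, det ε̄⁻¹, non-conjugate; ρ : Γ_ℚ → GL₄(ℚ̄_p)
irreducible, symplectic with similitude ε⁻¹, Greenberg-ordinary of shape (0,0,1,1) and residually
distinguished at p, a.e. Frobenius polynomial ≡ charpoly σ̄ · charpoly σ̄' — then ρ is automorphic
(the `IsAutomorphicAE` clause, inlined: L-algebraic cuspidal π on GL₄(𝔸_ℚ), Satake–Frobenius
matching a.e.). Oddness is deliberately redundant (follows from det ε̄⁻¹, p odd) so that the glue is
syntactic. (Cone repair 2026-08-15: Literature's `IsAutomorphicAE` clause and the mod-p cyclotomic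
character `modPCyclotomicCharacter{,ZMod}` are spelled out inline over Statement-cone vocabulary —
CuspidalAutomorphicRepData / IsLAlgebraic / HasSatakeParamAt / arithFrobPolyOfSatake, and Mathlib's
modularCyclotomicCharacter on Γ_ℚ — so that ModPGaloisRep.lean and IsAutomorphicAE.lean leave the
route's import cone; DEFINITIONALLY the rev-0 statement, Iff.rfl.) -/
@[route_item "route-Langlands-PhantomRMYoshida", crux]
def PhantomRMSector : Prop :=
  ∀ (p : ℕ) [Fact p.Prime], p ≠ 2 → ∀ (k : Type) [Field k] [CharP k p] [IsAlgClosed k] [TopologicalSpace k] [DiscreteTopology k] (red : Valued.integer (PadicAlgCl p) →+* k) (σ σ' : Literature.NumberTheory.GaloisRepresentations.FramedGaloisRep ℚ k 2) (hcpt : Literature.NumberTheory.Automorphic.isCompact_glFiniteIntegralLevel 4 ℚ) (ι : PadicAlgCl p ≃+* ℂ) (ρ : Literature.NumberTheory.GaloisRepresentations.FramedGaloisRep ℚ (PadicAlgCl p) 4), let εb : Field.absoluteGaloisGroup ℚ →* (ZMod p)ˣ := (modularCyclotomicCharacter (AlgebraicClosure ℚ) (HasEnoughRootsOfUnity.natCard_rootsOfUnity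 (AlgebraicClosure ℚ) p)).comp (MulSemiringAction.toRingAut (Field.absoluteGaloisGroup ℚ) (AlgebraicClosure ℚ)); σ.IsOdd → σ'.IsOdd → σ.toGaloisRep.IsIrreducible → σ'.toGaloisRep.IsIrreducible → (∀ g, Literature.NumberTheory.GaloisRepresentations.FramedRep.det σ g = (Units.map (ZMod.castHom (dvd_refl p) k).toMonoidHom (εb g))⁻¹ ∧ Literature.NumberTheory.GaloisRepresentations.FramedRep.det σ' g = Literature.NumberTheory.GaloisRepresentations.FramedRep.det σ g) → (¬ ∃ g : GL (Fin 2) k, ∀ x, g * σ x * g⁻¹ = σ' x) → ρ.toGaloisRep.IsIrreducible → (ρ.IsSymplecticWithMultiplierFun (fun g => algebraMap ℚ_[p] (PadicAlgCl p) ((((Literature.NumberTheory.GaloisRepresentations.GaloisRep.cyclotomicCharacter ℚ p g)⁻¹ : ℤ_[p]ˣ) : ℤ_[p]) : ℚ_[p])) ∧ (∀ v : IsDedekindDomain.HeightOneSpectrum (NumberField.RingOfIntegers ℚ), ((p : ℕ) : NumberField.RingOfIntegers ℚ) ∈ v.asIdeal → ρ.IsGreenbergOrdinaryOfShapeAt v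 ![0, 0, 1, 1] ∧ ρ.IsResiduallyDistinguishedAt v ![0, 0, 1, 1]) ∧ (∀ᶠ v : IsDedekindDomain.HeightOneSpectrum (NumberField.RingOfIntegers ℚ) in Filter.cofinite, ρ.IsUnramifiedAt v ∧ σ.IsUnramifiedAt v ∧ σ'.IsUnramifiedAt v ∧ ∃ (P : Polynomial (Valued.integer (PadicAlgCl p))) (P₁ P₂ : Polynomial k), ρ.HasFrobCharpolyAt v (P.map (Valued.integer (PadicAlgCl p)).subtype) ∧ σ.HasFrobCharpolyAt v P₁ ∧ σ'.HasFrobCharpolyAt v P₂ ∧ P.map red = P₁ * P₂)) → ∃ π : Literature.NumberTheory.Automorphic.CuspidalAutomorphicRepData 4 ℚ hcpt, π.1.IsLAlgebraic ∧ ∀ᶠ v : IsDedekindDomain.HeightOneSpectrum (NumberField.RingOfIntegers ℚ) in Filter.cofinite, ∃ a : Multiset ℂ, π.1.HasSatakeParamAt v a ∧ ρ.IsUnramifiedAt v ∧ ρ.HasFrobCharpolyAt v (Literature.NumberTheory.Automorphic.arithFrobPolyOfSatake ι v.residueCard 1 a)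

-- earlier ResiduallyYoshidaLifting (stmt-Langlands-12942, replaced 2026-08-15T19:29:53Z -> stmt-Langlands-13639): retired by None — ∀ (p : ℕ) [Fact p.Prime], p ≠ 2 → ∀ (k : Type) [Field k] [CharP k p] [IsAlgClosed k] [TopologicalSpace k] [DiscreteTopology k] (red : Valued.integer (PadicAlgCl p) →+* k) (σ σ' : Literature.NumberTheory.GaloisRepresentations.FramedGaloisRep ℚ k 2) (hcpt : Literature.Num
/-- item stmt-Langlands-13639 · crux · rank 2 · open · by planner
why it might fail: CODIM.md: reducible locus has codim 0 in the ordinary family, so Thorne/ANT smallness (Steinberg place) is dead at minimal level; live engine = patching at the endoscopic 𝔪 (ρ̄ GSp₄-Schur): needs Lagrangian-isotypic TW primes + wt-2 classicality at endoscopic 𝔪, not in print; BK2012: cyclic Selmer.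
sources: Thorne2014, AllenNewtonThorne2020, Thorne2012, BergerKlosin2012, BoxerEtAl2021, BoxerCalegariGeePilloni2025
[crux] RELATIVE AUTOMORPHY LIFTING AT A RESIDUALLY-YOSHIDA POINT IN WEIGHT (2,2) (card P1+P2): p
odd; σ̄, σ̄' odd irreducible non-conjugate with det ε̄⁻¹; ρ₀, ρ : Γ_ℚ → GL₄(ℚ̄_p) both irreducible,
symplectic-ε⁻¹, Greenberg-ordinary (0,0,1,1) and p-distinguished, both residually σ̄ ⊕ σ̄' through
the same red; if ρ₀ is automorphic then ρ is automorphic. Engines: (E1)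
Thorne2014/AllenNewtonThorne2020 connectedness-dimension patching with reducibility ideals,
transplanted from ordinary U(n)/CM to GSp₄/ℚ on the BoxerEtAl2021 higher-Hida complexes
(Calegari–Geraghty, ℓ₀ = 1), the reducible locus controlled through the KNOWN GL₂ Hida theory of the
constituents instead of a Steinberg place; (E2) BergerKlosin2012 §10 (principality of the
reducibility ideal, R/I ≅ 𝒪/ϖ^s from the Yoshida congruence module, no Taylor–Wiles primes), moved
from Siegel weight k/2+1 ≥ 3 to weight 2 along the ordinary family; then
BoxerCalegariGeePilloni2025-type classicality of the ordinary weight-2 eigensystem and GSp₄ → GL₄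
transfer (GeeTaibi2019). [deps: StableYoshidaCongruence] [difficulty: open-problem] (Cone repair
2026-08-15: Literature's `IsAutomorphicAE` clause and the mod-p cyclotomic character `modPCycl -/
@[route_item "route-Langlands-PhantomRMYoshida", crux]
def ResiduallyYoshidaLifting : Prop :=
  ∀ (p : ℕ) [Fact p.Prime], p ≠ 2 → ∀ (k : Type) [Field k] [CharP k p] [IsAlgClosed k] [TopologicalSpace k] [DiscreteTopology k] (red : Valued.integer (PadicAlgCl p) →+* k) (σ σ' : Literature.NumberTheory.GaloisRepresentations.FramedGaloisRep ℚ k 2) (hcpt : Literature.NumberTheory.Automorphic.isCompact_glFiniteIntegralLevel 4 ℚ) (ι : PadicAlgCl p ≃+* ℂ) (ρ₀ ρ : Literature.NumberTheory.GaloisRepresentations.FramedGaloisRep ℚ (PadicAlgCl p) 4), let εb : Field.absoluteGaloisGroup ℚ →* (ZMod p)ˣ := (modularCyclotomicCharacter (AlgebraicClosure ℚ) (HasEnoughRootsOfUnity.natCard_rootsOfUnity (AlgebraicClosure ℚ) p)).comp (MulSemiringAction.toRingAut (Field.absoluteGaloisGroup ℚ) (AlgebraicClosure ℚ)); let Aut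 := fun r : Literature.NumberTheory.GaloisRepresentations.FramedGaloisRep ℚ (PadicAlgCl p) 4 => (∃ π : Literature.NumberTheory.Automorphic.CuspidalAutomorphicRepData 4 ℚ hcpt, π.1.IsLAlgebraic ∧ ∀ᶠ v : IsDedekindDomain.HeightOneSpectrum (NumberField.RingOfIntegers ℚ) in Filter.cofinite, ∃ a : Multiset ℂ, π.1.HasSatakeParamAt v a ∧ r.IsUnramifiedAt v ∧ r.HasFrobCharpolyAt v (Literature.NumberTheory.Automorphic.arithFrobPolyOfSatake ι v.residueCard 1 a)); let Sh := fun r : Literature.NumberTheory.GaloisRepresentations.FramedGaloisRep ℚ (PadicAlgCl p) 4 => (r.IsSymplecticWithMultiplierFun (fun g => algebraMap ℚ_[p] (PadicAlgCl p) ((((Literature.NumberTheory.GaloisRepresentations.GaloisRep.cyclotomicCharacter ℚ p g)⁻¹ : ℤ_[p]ˣ) : ℤ_[p]) : ℚ_[p])) ∧ (∀ v : IsDedekindDomain.HeightOneSpectrum (NumberField.RingOfIntegers ℚ), ((p : ℕ) : NumberField.RingOfIntegers ℚ) ∈ v.asIdeal → r.IsGreenbergOrdinaryOfShapeAt v ![0,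 0, 1, 1] ∧ r.IsResiduallyDistinguishedAt v ![0, 0, 1, 1]) ∧ (∀ᶠ v : IsDedekindDomain.HeightOneSpectrum (NumberField.RingOfIntegers ℚ) in Filter.cofinite, r.IsUnramifiedAt v ∧ σ.IsUnramifiedAt v ∧ σ'.IsUnramifiedAt v ∧ ∃ (P : Polynomial (Valued.integer (PadicAlgCl p))) (P₁ P₂ : Polynomial k), r.HasFrobCharpolyAt v (P.map (Valued.integer (PadicAlgCl p)).subtype) ∧ σ.HasFrobCharpolyAt v P₁ ∧ σ'.HasFrobCharpolyAt v P₂ ∧ P.map red = P₁ * P₂)); σ.IsOdd → σ'.IsOdd → σ.toGaloisRep.IsIrreducible → σ'.toGaloisRep.IsIrreducible → (∀ g, Literature.NumberTheory.GaloisRepresentations.FramedRep.det σ g = (Units.map (ZMod.castHom (dvd_refl p) k).toMonoidHom (εb g))⁻¹ ∧ Literature.NumberTheory.GaloisRepresentations.FramedRep.det σ' g = Literature.NumberTheory.GaloisRepresentations.FramedRep.det σ g) → (¬ ∃ g : GL (Fin 2) k, ∀ x, g * σ x * g⁻¹ = σ' x) → ρ₀.toGaloisRep.IsIrreducible → Sh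 ρ₀ → Aut ρ₀ → ρ.toGaloisRep.IsIrreducible → Sh ρ → Aut ρ

-- earlier StableYoshidaCongruence (stmt-Langlands-12943, replaced 2026-08-15T19:29:53Z -> stmt-Langlands-13640): retired by None — ∀ (p : ℕ) [Fact p.Prime], p ≠ 2 → ∀ (k : Type) [Field k] [CharP k p] [IsAlgClosed k] [TopologicalSpace k] [DiscreteTopology k] (red : Valued.integer (PadicAlgCl p) →+* k) (σ σ' : Literature.NumberTheory.GaloisRepresentations.FramedGaloisRep ℚ k 2), let Sh := fun r : Lite
/-- item stmt-Langlands-13640 · crux · rank 3 · open · by planner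
why it might fail: Instance exhibited only for twist pairs σ̄′≅σ̄⊗χ_K, K real quadratic (Weil restriction of a 3-congruent E/K: ONEPAIR.md, FLS2015); for generic/phantom-RM pairs no wt-(2,2) endoscopic→stable congruence in print (BDSP2012 §9 needs k′−k≥6; Sorensen regular wt); cross-ratio primes can fail at p=3.
sources: Sorensen2006, Sorensen2009, LemmaOchiai2023, BochererDummiganSchulzePillot2012, HsiehPalvannan2025, FreitasLeHungSiksek2015
[crux] A STABLE AUTOMORPHIC POINT ON THE ORDINARY WEIGHT-2 DEFORMATION SPACE OF σ̄ ⊕ σ̄' (endoscopic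
→ stable congruence, auxiliary level allowed): p odd; σ̄, σ̄' irreducible, non-conjugate, det ε̄⁻¹,
each residually automorphic on GL₂ in the sense output by SerreKWAutomorphicGL2; if SOME ρ (possibly
reducible, e.g. ρ_f ⊕ ρ_f', or the sector's own ρ) is symplectic-ε⁻¹, Greenberg-ordinary (0,0,1,1),
p-distinguished with residual pair (σ̄, σ̄'), then for every ι there is an IRREDUCIBLE automorphic
ρ₀ of the same shape and residual pair — i.e. a stable weight-2 p-ordinary Siegel eigenform of some
level congruent to the Yoshida eigensystem of the pair, transferred to GL₄. Engines: weight-2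
ordinary newform lifts of σ̄, σ̄' (weight part of Serre + Hida), then level-raising at auxiliary
primes q whose Frobenius has a CROSS eigenvalue ratio q between σ̄ and σ̄' but no internal Ribet
ratio (forces the q-new form out of every Yoshida packet), on a compact-at-∞ inner form of GSp₄
(Sorensen2006) or in coherent H⁰/H¹ of the Siegel threefold; alternatively p | L_alg(f ⊗ f')
congruences (BochererDummiganSchulzePillot2012, Agarwal–Klosin, HsiehPalvannan2025); irreducibility
of ρ₀ from cuspidality -/
@[route_item "route-Langlands-PhantomRMYoshida", crux]
def StableYoshidaCongruence : Prop :=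
  ∀ (p : ℕ) [Fact p.Prime], p ≠ 2 → ∀ (k : Type) [Field k] [CharP k p] [IsAlgClosed k] [TopologicalSpace k] [DiscreteTopology k] (red : Valued.integer (PadicAlgCl p) →+* k) (σ σ' : Literature.NumberTheory.GaloisRepresentations.FramedGaloisRep ℚ k 2), let εb : Field.absoluteGaloisGroup ℚ →* (ZMod p)ˣ := (modularCyclotomicCharacter (AlgebraicClosure ℚ) (HasEnoughRootsOfUnity.natCard_rootsOfUnity (AlgebraicClosure ℚ) p)).comp (MulSemiringAction.toRingAut (Field.absoluteGaloisGroup ℚ) (AlgebraicClosure ℚ)); let Sh := fun r : Literature.NumberTheory.GaloisRepresentations.FramedGaloisRep ℚ (PadicAlgCl p) 4 => (r.IsSymplecticWithMultiplierFun (fun g => algebraMap ℚ_[p] (PadicAlgCl p) ((((Literature.NumberTheory.GaloisRepresentations.GaloisRep.cyclotomicCharacter ℚ p g)⁻¹ : ℤ_[p]ˣ) : ℤ_[p]) : ℚ_[p])) ∧ (∀ v : IsDedekindDomain.HeightOneSpectrum (NumberField.RingOfIntegers ℚ), ((p : ℕ) : NumberField.RingOfIntegers ℚ) ∈ v.asIdeal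 → r.IsGreenbergOrdinaryOfShapeAt v ![0, 0, 1, 1] ∧ r.IsResiduallyDistinguishedAt v ![0, 0, 1, 1]) ∧ (∀ᶠ v : IsDedekindDomain.HeightOneSpectrum (NumberField.RingOfIntegers ℚ) in Filter.cofinite, r.IsUnramifiedAt v ∧ σ.IsUnramifiedAt v ∧ σ'.IsUnramifiedAt v ∧ ∃ (P : Polynomial (Valued.integer (PadicAlgCl p))) (P₁ P₂ : Polynomial k), r.HasFrobCharpolyAt v (P.map (Valued.integer (PadicAlgCl p)).subtype) ∧ σ.HasFrobCharpolyAt v P₁ ∧ σ'.HasFrobCharpolyAt v P₂ ∧ P.map red = P₁ * P₂)); let AutGL2 := fun s : Literature.NumberTheory.GaloisRepresentations.FramedGaloisRep ℚ k 2 => (∀ (hcpt₂ : Literature.NumberTheory.Automorphic.isCompact_glFiniteIntegralLevel 2 ℚ) (ι : PadicAlgCl p ≃+* ℂ), ∃ π₂ : Literature.NumberTheory.Automorphic.CuspidalAutomorphicRepData 2 ℚ hcpt₂, π₂.1.IsLAlgebraic ∧ ∀ᶠ v : IsDedekindDomain.HeightOneSpectrum (NumberField.RingOfIntegers ℚ)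 in Filter.cofinite, ∃ (a : Multiset ℂ) (P : Polynomial (Valued.integer (PadicAlgCl p))) (Pb : Polynomial k), π₂.1.HasSatakeParamAt v a ∧ P.map (Valued.integer (PadicAlgCl p)).subtype = Literature.NumberTheory.Automorphic.arithFrobPolyOfSatake ι v.residueCard 1 a ∧ s.IsUnramifiedAt v ∧ s.HasFrobCharpolyAt v Pb ∧ P.map red = Pb); AutGL2 σ → AutGL2 σ' → σ.toGaloisRep.IsIrreducible → σ'.toGaloisRep.IsIrreducible → (∀ g, Literature.NumberTheory.GaloisRepresentations.FramedRep.det σ g = (Units.map (ZMod.castHom (dvd_refl p) k).toMonoidHom (εb g))⁻¹ ∧ Literature.NumberTheory.GaloisRepresentations.FramedRep.det σ' g = Literature.NumberTheory.GaloisRepresentations.FramedRep.det σ g) → (¬ ∃ g : GL (Fin 2) k, ∀ x, g * σ x * g⁻¹ = σ' x) → (∃ ρ : Literature.NumberTheory.GaloisRepresentations.FramedGaloisRep ℚ (PadicAlgCl p) 4, Sh ρ) → ∀ (hcpt : Literature.NumberTheory.Automorphic.isCompact_glFiniteIntegralLevel 4 ℚ) (ι : PadicAlgCl p ≃+* ℂ),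 ∃ ρ₀ : Literature.NumberTheory.GaloisRepresentations.FramedGaloisRep ℚ (PadicAlgCl p) 4, ρ₀.toGaloisRep.IsIrreducible ∧ Sh ρ₀ ∧ (∃ π : Literature.NumberTheory.Automorphic.CuspidalAutomorphicRepData 4 ℚ hcpt, π.1.IsLAlgebraic ∧ ∀ᶠ v : IsDedekindDomain.HeightOneSpectrum (NumberField.RingOfIntegers ℚ) in Filter.cofinite, ∃ a : Multiset ℂ, π.1.HasSatakeParamAt v a ∧ ρ₀.IsUnramifiedAt v ∧ ρ₀.HasFrobCharpolyAt v (Literature.NumberTheory.Automorphic.arithFrobPolyOfSatake ι v.residueCard 1 a))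

/-- item stmt-Langlands-12944 · crux (kind.auto-crux: conjecture-grade) · rank 9 · open · by planner
why it might fail: Not open: KW2009 Thm 1.2+9.1 (Kisin 2-adic), refuter-vetted 'faithfully typed'. Fails only AS TYPED: the unbuilt XL newform→CuspidalAutomorphicRepData dictionary must give an L-algebraic π₂ with p-integral Satake polynomial ∏(X−ι⁻¹a_j⁻¹) reducing to charpoly σ̄; convention slip = misstated.
sources: KhareWintenberger2009, KhareWintenberger2009II, Kisin2009TwoAdic, Carayol1986, BuzzardGeeLMS2014, Gelbart1975
[support] NAMED-FACT GATE, typed fact-free (first hypothesis of `closes`): Serre's conjecture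
(Khare–Wintenberger–Kisin) in the summit's automorphic L-normalisation — for every prime p, k
algebraically closed of characteristic p, red : 𝒪_ℚ̄_p → k and every odd irreducible σ̄ : Γ_ℚ →
GL₂(k), and every ι, there is an L-algebraic cuspidal π₂ of GL₂(𝔸_ℚ) whose Satake polynomials ∏(X −
ι⁻¹(a_j⁻¹)) at almost all v are p-integral and reduce through red to charpoly σ̄(Frob_v) (π₂ = π_f ⊗
|det|^((k−1)/2) up to a finite twist/Galois conjugation, f the KW newform). Theorem in print:
KhareWintenberger2009 Thm 1.2/9.1 + Kisin2009TwoAdic + Deligne/Carayol + BuzzardGeeLMS2014 §3; in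
the tree the Galois-side weak form is the named fact
`Literature.NumberTheory.Automorphic.exists_newform_of_odd_irreducible` (lang.S37), deliberately NOT
referenced so that no unproved Literature Prop enters the cone; the residual risk is the
classical→adelic dictionary and the sign of the half-twist. [difficulty: XL] -/
@[route_item "route-Langlands-PhantomRMYoshida", crux]
def SerreKWAutomorphicGL2 : Prop :=
  ∀ (p : ℕ) [Fact p.Prime] (k : Type) [Field k] [CharP k p] [IsAlgClosed k] [TopologicalSpace k] [DiscreteTopology k] (red : Valued.integer (PadicAlgCl p) →+* k) (σ : Literature.NumberTheory.GaloisRepresentations.FramedGaloisRep ℚ k 2), σ.IsOdd → σ.toGaloisRep.IsIrreducible → ∀ (hcpt₂ : Literature.NumberTheory.Automorphic.isCompact_glFiniteIntegralLevel 2 ℚ) (ι : PadicAlgCl p ≃+* ℂ), ∃ π₂ : Literature.NumberTheory.Automorphic.CuspidalAutomorphicRepData 2 ℚ hcpt₂, π₂.1.IsLAlgebraic ∧ ∀ᶠ v : IsDedekindDomain.HeightOneSpectrum (NumberField.RingOfIntegers ℚ) in Filter.cofinite, ∃ (a : Multiset ℂ) (P : Polynomial (Valued.integer (PadicAlgCl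 p))) (Pb : Polynomial k), π₂.1.HasSatakeParamAt v a ∧ P.map (Valued.integer (PadicAlgCl p)).subtype = Literature.NumberTheory.Automorphic.arithFrobPolyOfSatake ι v.residueCard 1 a ∧ σ.IsUnramifiedAt v ∧ σ.HasFrobCharpolyAt v Pb ∧ P.map red = Pb

-- earlier PhantomRMJunction (stmt-Langlands-12945, replaced 2026-08-15T19:29:53Z -> stmt-Langlands-13643): retired by None — PhantomRMSector → _root_.Langlands
/-- item stmt-Langlands-13643 · crux · rank 9 · open · by planner
why it might fail: It is the REST of GL_n reciprocity: direction (A) for all n, F (no ρ_π for non-polarisable π, n≥3); (B) beyond odd symplectic wt-(2,2) ρ/ℚ (even ρ, general F); local–global compatibility at every v incl. v∣ℓ (pinned D_pst); a.e.-Satake ⇒ Corresponds. Wide open; closes only with the summit.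
sources: BuzzardGeeLMS2014, FontaineMazurGeometric1995, TaylorGaloisRepresentations2004, ArthurClozelAMS120, HarrisLanTaylorThorne2016, Scholze2015
[support] the rest of the summit: PhantomRMSector → Langlands (upgrade a.e. matching to Corresponds
by local–global compatibility and strong multiplicity one; direction (A); all other n, F, weights,
residual classes). Not this route's business; true iff Langlands; filed so that `closes` ends in the
summit constant; shared junction for every GSp₄/abelian-surface card stated through PhantomRMSector.
[difficulty: open-problem] (Re-issued 2026-08-15 at the cone repair in the definitionally equal
spelling `∀ _ : PhantomRMSector, Langlands` of `PhantomRMSector → Langlands`, only so that it prints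
after the restated PhantomRMSector.) -/
@[route_item "route-Langlands-PhantomRMYoshida", crux]
def PhantomRMJunction : Prop :=
  ∀ _ : PhantomRMSector, _root_.Langlands

/-- item stmt-Langlands-15084 · crux · rank 9 · open · by planner
why it might fail: Not open: Faltings1983 §6 Satz 5–6 + Zarhin (MilneAV2008 IV.1.1); fails only AS TYPED. xl-apex GATE (heights, Néron, Tate–Raynaud, Hodge–Tate absent). Masser–Wüstholz road exists_isogeny_kerRank_le_of_isIsogenous (MW1995 Thm II) is kernel-checked EQUIVALENT, equally xl-apex: cite, do not staff.
sources: Faltings1983Endlichkeit, Faltings1986FinitenessTranslation, MilneAV2008, Milne1986AbelianVarieties, MasserWustholz1993, MasserWustholz1995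
[crux] NAMED-FACT GATE (route-choice 2026-08-16): FALTINGS' FINITENESS I over ℚ — for every abelian
variety A/ℚ only finitely many B/ℚ, up to isomorphism in `AbelianVariety ℚ` (group-scheme isos),
admit an isogeny B → A; verbatim the tree fact
`Literature.AlgebraicGeometry.Motives.AbelianVariety.finite_isoClasses_isogenous A`
(Motives/FaltingsFinitenessI.lean, no `_holds`) at K = ℚ with its `[NumberField ℚ]` binder
instantiated (planner SketchReductions2.lean `faltingsFinitenessI_iff`), inlined so that the route
cone is unchanged. (why it might fail: not open — Faltings1983Endlichkeit §6 Satz 5–6 + Zarhin,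
MilneAV2008 IV Thm 1.1; fails only AS TYPED; unprovable in-tree today: Faltings height, Néron
models, Tate–Raynaud, Hodge–Tate all absent = XL-apex, fact lane gave up after the split child was
reviewed twice) [sources: Faltings1983Endlichkeit, Faltings1986FinitenessTranslation, MilneAV2008,
Milne1986AbelianVarieties, MasserWustholz1993] WHY AN ITEM: it is the in-tree APEX of the two
Faltings facts consumed by crux 3's picked line level-three-weierstrass-switch
(stub_tateModuleIrreducible / Theorems/…TateModuleIrreducible.lean):
Motives/FaltingsAbelianOfFinitenessIProofs.lean deri -/
@[route_item "route-Langlands-PhantomRMYoshida", crux]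
def FaltingsFinitenessI : Prop :=
  ∀ A : Literature.AlgebraicGeometry.Motives.AbelianVariety ℚ, ∃ (n : ℕ) (C : Fin n → Literature.AlgebraicGeometry.Motives.AbelianVariety ℚ), ∀ B : Literature.AlgebraicGeometry.Motives.AbelianVariety ℚ, Literature.AlgebraicGeometry.Motives.AbelianVariety.IsIsogenous B A → ∃ i, Nonempty (B ≅ C i)

/-- item stmt-Langlands-15085 · support · rank 8 · open · by planner
[crux] NAMED-FACT GATE (route-choice repair 2026-08-16, unit
rchoice-Summits-Langlands-Langlands-Cr-a1cac178): FALTINGS' TATE-MODULE THEOREMS OVER ℚ — for every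
prime p and every abelian variety B/ℚ (tree `AbelianVariety ℚ`: a proper, geometrically integral
group scheme over Spec ℚ), (i) the Tate map ℤ_p ⊗_ℤ End_ℚ(B) → End_{Γ_ℚ}(T_p B), c ⊗ f ↦ c·T_p f
(`AbelianVariety.faltingsTateMap B B p`), is bijective — Faltings 1983 §5 Satz 4 (= Korollar 1 with
A₁ = A₂ = B) — and (ii) V_p B = T_p B ⊗ ℚ_p (`AbelianVariety.rationalTateRep B p`) is a semisimple
ℚ_p[Γ_ℚ]-module — Satz 3. Typed FACT-FREE over the Tate-module vocabulary of
AVIsogenyTate/AVGaloisModule; EQUIVALENT (planner ConeProbe.lean rc 0, both directions one-liners,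
the NumberField instance binder being unused) to the conjunction over ℚ of the Literature named
facts `faltings_tate_bijective B B p` ∧ `isSemisimpleRepresentation_rationalTateRep B p` (hodge.S27;
cite-only, no `_holds`), judged XL-apex as Literature facts (too large for one seat; non-crux facts
are not split) and therefore promoted to an explicit crux of this route rather than left as hidden
hypotheses of a crux line. A THEOREM IN PRINT, XL and unformalised (Satz 1 -/
@[route_item "route-Langlands-PhantomRMYoshida"]
def FaltingsTateModuleQ : Prop :=
  (∀ (p : ℕ) [Fact p.Prime] (B : Literature.AlgebraicGeometry.Motives.AbelianVariety ℚ), Function.Bijective (Literature.AlgebraicGeometry.Motives.AbelianVariety.faltingsTateMap B B p)) ∧ (∀ (p : ℕ) [Fact p.Prime] (B : Literature.AlgebraicGeometry.Motives.AbelianVariety ℚ), (Literature.AlgebraicGeometry.Motives.AbelianVariety.rationalTateRep B p).IsSemisimpleRepresentation)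

/-- item stmt-Langlands-15166 · support · rank 8 · open · by planner
[crux] THE MASSER–WÜSTHOLZ ISOGENY-KERNEL BOUND OVER ℚ (route-choice 2026-08-16, unit
rchoice-Summits-Langlands-Langlands-Th-914848a1; PROMOTED from the cite-only Literature fact
`Literature.NumberTheory.DiophantineGeometry.exists_isogeny_kerRank_le_of_isIsogenous` at K = ℚ,
reviewed xl-apex): for every abelian variety A/ℚ there is N such that every B/ℚ admitting an isogeny
B → A is the target of an isogeny g : A → B with Hom.kerRank g ≤ N (order of the kernel group scheme
= deg g). ∃g form ONLY — the ∀g form is false ([N+1]_E: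
Theorems/FaltingsFinitenessI/Negative/NotIsogenyKernelBoundForall.lean). In print:
MasserWustholz1995 Thm II (p. 6; polarisation-free, deg ≤ C(n,d)·max(1,h(A))^κ), MasserWustholz1993
= BakerWustholz2007 Thm 7.5 (polarised), Bost1996Bourbaki795 Th. 3.5, explicit GaudronRemond2014 Thm
1.4. VERBATIM the registered stub K1 `stub_isogenyKernelBound` of line `Sketch` of crux
stmt-Langlands-15084 and, pointwise in A, the Literature fact with its [NumberField ℚ] binder
discharged (planner SketchB.lean `isogenyKernelBound_iff_forall_masserWustholz`, syntactic both
ways; lean rc 0). WHY A TOP-LEVEL CRUX: it is the single transcendental kernel on which the route's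
whol -/
@[route_item "route-Langlands-PhantomRMYoshida"]
def IsogenyKernelBound : Prop :=
  ∀ A : Literature.AlgebraicGeometry.Motives.AbelianVariety ℚ, ∃ N : ℕ, ∀ B : Literature.AlgebraicGeometry.Motives.AbelianVariety ℚ, Literature.AlgebraicGeometry.Motives.AbelianVariety.IsIsogenous B A → ∃ g : A ⟶ B, Literature.AlgebraicGeometry.Motives.AbelianVariety.IsIsogeny g ∧ Literature.AlgebraicGeometry.Motives.AbelianVariety.Hom.kerRank g ≤ N

-- earlier PhantomRMTransport (stmt-Langlands-12946, replaced 2026-08-15T19:29:53Z -> stmt-Langlands-13641): retired by None — ∀ (p : ℕ) [Fact p.Prime], p ≠ 2 → ∀ (k : Type) [Field k] [CharP k p] [IsAlgClosed k] [TopologicalSpace k] [DiscreteTopology k] (ρb : Literature.NumberTheory.GaloisRepresentations.FramedGaloisRep ℚ (ZMod p) 4) (J Φ : Matrix (Fin 4) (Fin 4) (ZMod p)) (a b : ZMod p), J.transpose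
/-- item stmt-Langlands-13641 · support · rank 9 · closed · proved by Summit.Langlands.Langlands.Theorems.phantomRMTransport_proof @ a8388cb34c37 (prover) · by planner
sources: doi:10.1007/BF01388470, KhareWintenberger2009, BoxerCalegariGeePilloni2025
[support] THE TRANSPORT LEMMA (card P3; linear algebra + Clifford theory, provable now),
cohomological convention: p odd, k algebraically closed of characteristic p; ρ̄ : Γ_ℚ → GL₄(𝔽_p)
continuous, IRREDUCIBLE, preserving an alternating non-degenerate J with multiplier ε̄⁻¹, whose
commutant is exactly 𝔽_p[Φ] ≅ 𝔽_p² (Φ² = aΦ + b, X² − aX − b irreducible) with Φ J-self-adjoint (Φᵀ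
J = J Φ: Sp₂(p²)-type of Aschbacher class C₃, not the GU₂(p)-type). Then ρ̄ ⊗ k is conjugate to the
block-diagonal σ ⊕ σ^(p) with σ : Γ_ℚ → GL₂(k) odd, irreducible, det σ = ε̄⁻¹ and σ not conjugate to
σ^(p). Proof sketch: the eigenplanes W, W' of Φ ⊗ k (eigenvalues λ ≠ λ^p) are Γ-stable; Φ* = Φ gives
(λ − λ^p)⟨W, W'⟩ = 0, so each plane is J-non-degenerate, det σ = multiplier, σ odd; irreducibility
of ρ̄ + End = 𝔽_p² give absolute irreducibility of V over 𝔽_p², hence of σ = V ⊗ k, and σ ≇ σ^(p)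
(else End ⊗ k would be M₂(k), of dimension 4 ≠ 2). [difficulty: M] (Cone repair 2026-08-15: the
mod-p cyclotomic character `modPCyclotomicCharacter{,ZMod}` is spelled out inline over
Statement-cone vocabulary — Mathlib's modularCyclotomicCharacter on Γ_ℚ — so that ModPGaloisRep.lean
leaves the route's import cone; DEF -/
@[route_item "route-Langlands-PhantomRMYoshida"]
def PhantomRMTransport : Prop :=
  ∀ (p : ℕ) [Fact p.Prime], p ≠ 2 → ∀ (k : Type) [Field k] [CharP k p] [IsAlgClosed k] [TopologicalSpace k] [DiscreteTopology k] (ρb : Literature.NumberTheory.GaloisRepresentations.FramedGaloisRep ℚ (ZMod p) 4) (J Φ : Matrix (Fin 4) (Fin 4) (ZMod p)) (a b : ZMod p), let εb : Field.absoluteGaloisGroup ℚ →* (ZMod p)ˣ := (modularCyclotomicCharacter (AlgebraicClosure ℚ) (HasEnoughRootsOfUnity.natCard_rootsOfUnity (AlgebraicClosure ℚ) p)).comp (MulSemiringAction.toRingAut (Field.absoluteGaloisGroup ℚ) (AlgebraicClosure ℚ)); J.transpose = -J → J.det ≠ 0 → (∀ g, (ρb g).val.transpose * J * (ρb g).val =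 (((εb g)⁻¹ : (ZMod p)ˣ) : ZMod p) • J) → Irreducible (Polynomial.X ^ 2 - Polynomial.C a * Polynomial.X - Polynomial.C b : Polynomial (ZMod p)) → Φ * Φ = a • Φ + b • (1 : Matrix (Fin 4) (Fin 4) (ZMod p)) → (∀ X : Matrix (Fin 4) (Fin 4) (ZMod p), (∀ g, X * (ρb g).val = (ρb g).val * X) ↔ ∃ c d : ZMod p, X = c • (1 : Matrix (Fin 4) (Fin 4) (ZMod p)) + d • Φ) → Φ.transpose * J = J * Φ → ρb.toGaloisRep.IsIrreducible → ∃ (σ : Literature.NumberTheory.GaloisRepresentations.FramedGaloisRep ℚ k 2) (g : GL (Fin 4) k), σ.IsOdd ∧ σ.toGaloisRep.IsIrreducible ∧ (∀ x, Literature.NumberTheory.GaloisRepresentations.FramedRep.det σ x = (Units.map (ZMod.castHom (dvd_refl p) k).toMonoidHom (εb x))⁻¹) ∧ (¬ ∃ h : GL (Fin 2) k, ∀ x, h * σ x * h⁻¹ = (Literature.NumberTheory.GaloisRepresentations.FramedRep.baseChange (frobenius k p) continuous_of_discreteTopology σ) x) ∧ ∀ x, (g⁻¹ * (Literature.NumberTheory.GaloisRepresentations.FramedRep.baseChange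 (ZMod.castHom (dvd_refl p) k) continuous_of_discreteTopology ρb) x * g).val = Matrix.reindex finSumFinEquiv finSumFinEquiv (Matrix.fromBlocks (σ x).val 0 0 ((Literature.NumberTheory.GaloisRepresentations.FramedRep.baseChange (frobenius k p) continuous_of_discreteTopology σ) x).val)

-- earlier RegularWeightRehearsal (stmt-Langlands-12947, replaced 2026-08-15T19:29:53Z -> stmt-Langlands-13642): retired by None — ∀ (p : ℕ) [Fact p.Prime], p ≠ 2 → ∀ (k : Type) [Field k] [CharP k p] [IsAlgClosed k] [TopologicalSpace k] [DiscreteTopology k] (red : Valued.integer (PadicAlgCl p) →+* k) (σ σ' : Literature.NumberTheory.GaloisRepresentations.FramedGaloisRep ℚ k 2) (hcpt : Literature.Numbe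
/-- item stmt-Langlands-13642 · support · rank 9 · open · by planner
sources: AllenNewtonThorne2020, Thorne2014, BergerKlosin2012, ArthurClozelAMS120, GeeTaibi2019
[support] REGULAR-WEIGHT DRESS REHEARSAL of crux 2 (scalar Siegel weight 3: Hodge–Tate shape
(0,1,2,3), similitude ε⁻³, residual pair with det ε̄⁻³, e.g. ρ̄_g ⊕ ρ̄_f ε̄⁻¹ for g ∈ S₄, f ∈ S₂):
the same relative lifting statement with the regular Greenberg shape (0,1,2,3). Expected to follow,
for p ≥ 7 and σ̄|, σ̄'| on Γ_ℚ(ζ_p) absolutely irreducible, from AllenNewtonThorne2020 Thm 1.1 over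
an imaginary quadratic K in which p splits (ρ|Γ_K is conjugate self-dual up to twist, ordinary of
regular weight, residually multiplicity-free) modulo its locally-Steinberg hypothesis, plus cyclic
base change/descent (ArthurClozelAMS120) and GSp₄ ↔ GL₄ (GeeTaibi2019); BergerKlosin2012 §10 Thm 77
is its fixed-level conditional form. Closing it (even modulo named facts) certifies the
Galois-theoretic half of crux 2 before the irregular weight is attempted and isolates exactly what
the Steinberg hypothesis costs. [difficulty: L] (Cone repair 2026-08-15: Literature's
`IsAutomorphicAE` clause and the mod-p cyclotomic character `modPCyclotomicCharacter{,ZMod}` are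
spelled out inline over Statement-cone vocabulary — CuspidalAutomorphicRepData / IsLAlgebraic /
HasSatakeParamAt / arithFrobPolyOfSatake, and -/
@[route_item "route-Langlands-PhantomRMYoshida"]
def RegularWeightRehearsal : Prop :=
  ∀ (p : ℕ) [Fact p.Prime], p ≠ 2 → ∀ (k : Type) [Field k] [CharP k p] [IsAlgClosed k] [TopologicalSpace k] [DiscreteTopology k] (red : Valued.integer (PadicAlgCl p) →+* k) (σ σ' : Literature.NumberTheory.GaloisRepresentations.FramedGaloisRep ℚ k 2) (hcpt : Literature.NumberTheory.Automorphic.isCompact_glFiniteIntegralLevel 4 ℚ) (ι : PadicAlgCl p ≃+* ℂ) (ρ₀ ρ : Literature.NumberTheory.GaloisRepresentations.FramedGaloisRep ℚ (PadicAlgCl p) 4), let εb : Field.absoluteGaloisGroup ℚ →* (ZMod p)ˣ := (modularCyclotomicCharacter (AlgebraicClosure ℚ) (HasEnoughRootsOfUnity.natCard_rootsOfUnity (AlgebraicClosure ℚ) p)).comp (MulSemiringAction.toRingAut (Field.absoluteGaloisGroup ℚ) (AlgebraicClosure ℚ)); let Aut := fun r : Literature.NumberTheory.GaloisRepresentations.FramedGaloisRep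 ℚ (PadicAlgCl p) 4 => (∃ π : Literature.NumberTheory.Automorphic.CuspidalAutomorphicRepData 4 ℚ hcpt, π.1.IsLAlgebraic ∧ ∀ᶠ v : IsDedekindDomain.HeightOneSpectrum (NumberField.RingOfIntegers ℚ) in Filter.cofinite, ∃ a : Multiset ℂ, π.1.HasSatakeParamAt v a ∧ r.IsUnramifiedAt v ∧ r.HasFrobCharpolyAt v (Literature.NumberTheory.Automorphic.arithFrobPolyOfSatake ι v.residueCard 1 a)); let Sh := fun r : Literature.NumberTheory.GaloisRepresentations.FramedGaloisRep ℚ (PadicAlgCl p) 4 => (r.IsSymplecticWithMultiplierFun (fun g => algebraMap ℚ_[p] (PadicAlgCl p) ((((Literature.NumberTheory.GaloisRepresentations.GaloisRep.cyclotomicCharacter ℚ p g)⁻¹ : ℤ_[p]ˣ) : ℤ_[p]) : ℚ_[p]) ^ 3) ∧ (∀ v : IsDedekindDomain.HeightOneSpectrum (NumberField.RingOfIntegers ℚ), ((p : ℕ) : NumberField.RingOfIntegers ℚ) ∈ v.asIdeal → r.IsGreenbergOrdinaryOfShapeAt v ![0, 1, 2, 3]) ∧ (∀ᶠ v : IsDedekindDomain.HeightOneSpectrum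 (NumberField.RingOfIntegers ℚ) in Filter.cofinite, r.IsUnramifiedAt v ∧ σ.IsUnramifiedAt v ∧ σ'.IsUnramifiedAt v ∧ ∃ (P : Polynomial (Valued.integer (PadicAlgCl p))) (P₁ P₂ : Polynomial k), r.HasFrobCharpolyAt v (P.map (Valued.integer (PadicAlgCl p)).subtype) ∧ σ.HasFrobCharpolyAt v P₁ ∧ σ'.HasFrobCharpolyAt v P₂ ∧ P.map red = P₁ * P₂)); σ.IsOdd → σ'.IsOdd → σ.toGaloisRep.IsIrreducible → σ'.toGaloisRep.IsIrreducible → (∀ g, Literature.NumberTheory.GaloisRepresentations.FramedRep.det σ g = (Units.map (ZMod.castHom (dvd_refl p) k).toMonoidHom (εb g))⁻¹ ^ 3 ∧ Literature.NumberTheory.GaloisRepresentations.FramedRep.det σ' g = Literature.NumberTheory.GaloisRepresentations.FramedRep.det σ g) → (¬ ∃ g : GL (Fin 2) k, ∀ x, g * σ x * g⁻¹ = σ' x) → ρ₀.toGaloisRep.IsIrreducible → Sh ρ₀ → Aut ρ₀ → ρ.toGaloisRep.IsIrreducible → Sh ρ → Aut ρ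

-- item stmt-Langlands-13864 · support · rank 9 · open · by planner — informal only, no Lean statement yet:
--   [support] [computation] PHANTOM-RM CENSUS (card P5; refuter's "cheap first deliverable"): over the
--   LMFDB genus-2 database (curves over ℚ with End(J_ℚ̄) = ℤ), for p ∈ {3, 5}: (a) list the curves whose
--   mod-p representation ρ̄_{J,p} : Γ_ℚ → GSp₄(𝔽_p) is 𝔽_p-IRREDUCIBLE but NOT absolutely irreducible
--   (commutant 𝔽_p²; Aschbacher class C₃ of degree 2), using the image labels of
--   Banwait–Brumer–Kim–Klagsbrun–Mayle–Srinivasan–Vogt arXiv:2301.02222 where available, else Frobenius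
--   charpoly factorisation patterns over 𝔽_p vs 𝔽_p² up to a bound; (b) split them into the Sp₂(p²)-type
--   (self-adjoint commutant,

/-- item stmt-Langlands-14471 · support · rank 9 · closed · proved by Summit.Langlands.Langlands.Theorems.PhantomRMYoshida.sectorGlue_proof @ b89d4aaecdbd (prover) · by planner
sources: Thorne2014, BoxerCalegariGeePilloni2025, KhareWintenberger2009
[support] GLUE, provable now by pure logic (the λ-term already inlined in `closes`; planner
Sketch.lean rc 0, axioms propext / Classical.choice / Quot.sound): the three cruxes imply the target
sector — SerreKWAutomorphicGL2 → StableYoshidaCongruence → ResiduallyYoshidaLifting →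
PhantomRMSector. Proof: fix the sector's data and hypotheses; SerreKWAutomorphicGL2 at σ̄ and at σ̄'
(odd, irreducible) discharges the two GL₂-automorphy hypotheses of StableYoshidaCongruence, whose '∃
ρ of shape Sh' hypothesis is witnessed by the sector's own ρ; it returns an irreducible automorphic
ρ₀ of the same shape and residual pair, and ResiduallyYoshidaLifting moves automorphy from ρ₀ to ρ
(every hypothesis is passed on syntactically; the `let` abbreviations zeta-reduce). Filed 2026-08-16
at the badge repair (route-repair unit rbadge-Langlands-PhantomRMYoshida-f172ac72) so that an ITEM
concludes the target PhantomRMSector (gate stamp route.target-unreachable); composed with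
PhantomRMJunction it is exactly the Assembly item, and `closes` is unchanged. For the prover,
verbatim: `theorem sectorGlue_holds : SectorGlue := fun hKW hS hL p _ hp k _ _ _ _ _ red σ σ' hcpt ι
ρ hσ hσ' hirr hirr' hdet hnc hρirr -/
@[route_item "route-Langlands-PhantomRMYoshida"]
def SectorGlue : Prop :=
  SerreKWAutomorphicGL2 → StableYoshidaCongruence → ResiduallyYoshidaLifting → PhantomRMSector

/-- item stmt-Langlands-15048 · support · rank 9 · closed · proved by Summit.Langlands.Langlands.Theorems.PhantomRMYoshida.yoshidaResidualSp4Schur_proof (prover) · by planner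
sources: doi:10.1007/BF01388470, Thorne2012, BoxerEtAl2021
[support] THE GSp₄-SCHUR PROPERTY OF THE YOSHIDA RESIDUAL TYPE (kernel of the codimension
computation CODIM.md §2, judge repair 2026-08-16; provable now, linear algebra + Schur): p odd, k
algebraically closed of characteristic p; σ̄, σ̄′ : Γ_ℚ → GL₂(k) irreducible and non-conjugate. Then
every X = (A B; C D) ∈ 𝔰𝔭₄(k) — XᵀJ + JX = 0 for the orthogonal-sum form J = J₂ ⊕ J₂, J₂ = (0 1; −1
0), i.e. the route's residual Yoshida type of two orthogonal non-degenerate planes — commuting with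
the block-diagonal ρ̄ = σ̄ ⊕ σ̄′ vanishes: H⁰(Γ_ℚ, 𝔰𝔭₄(ρ̄)) = 0 although ρ̄ is reducible. Proof:
commuting forces Bσ̄′(x) = σ̄(x)B, so B ∈ Hom_Γ(σ̄′, σ̄) = 0 (Schur: a non-zero intertwiner of
irreducibles is an isomorphism, excluded by non-conjugacy), likewise C = 0, and A ∈ End_Γ(σ̄) = k·1,
D = d·1 (Schur over algebraically closed k, via Module.End / eigenvalue of A commuting with an
irreducible image); then XᵀJ + JX = (2a J₂) ⊕ (2d J₂) = 0 gives a = d = 0 since p ≠ 2 (AᵀJ₂ + J₂A =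
(tr A)·J₂ for 2×2 A). Why it matters: it is the tangent-level condition End_{k[Γ]}(ρ̄) ∩ 𝔤 = 𝔷 under
which the unframed GSp₄-deformation functor of the SPLIT residual representation is
pro-representable and h⁰(ad⁰ρ̄) = 0 en -/
@[route_item "route-Langlands-PhantomRMYoshida"]
def YoshidaResidualSp4Schur : Prop :=
  ∀ (p : ℕ) [Fact p.Prime], p ≠ 2 → ∀ (k : Type) [Field k] [CharP k p] [IsAlgClosed k] [TopologicalSpace k] [DiscreteTopology k] (σ σ' : Literature.NumberTheory.GaloisRepresentations.FramedGaloisRep ℚ k 2), σ.toGaloisRep.IsIrreducible → σ'.toGaloisRep.IsIrreducible → (¬ ∃ g : GL (Fin 2) k, ∀ x, g * σ x * g⁻¹ = σ' x) → ∀ (A B C D : Matrix (Fin 2) (Fin 2) k), let J₂ : Matrix (Fin 2) (Fin 2) k := !![0, 1; -1, 0]; let X : Matrix (Fin 2 ⊕ Fin 2) (Fin 2 ⊕ Fin 2) k := Matrix.fromBlocks A B C D; let J : Matrix (Fin 2 ⊕ Fin 2) (Fin 2 ⊕ Fin 2) k := Matrix.fromBlocks J₂ 0 0 J₂; X.transpose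 * J + J * X = 0 → (∀ x, X * Matrix.fromBlocks (σ x).val 0 0 (σ' x).val = Matrix.fromBlocks (σ x).val 0 0 (σ' x).val * X) → X = 0

-- item stmt-Langlands-15057 · support · rank 9 · open · by planner — informal only, no Lean statement yet:
--   [support] [computation] ONE-PAIR CERTIFICATE (judge repair 2026-08-16; extends planner evidence
--   ONEPAIR.md / ONEPAIR-numerics.md on stmt-Langlands-13640). The PRODUCED weight-(2,2)
--   endoscopic-to-stable congruence: pair (f₁, f₂) = (f_11a, f_11a ⊗ χ₅), p = 3; stable side Π =
--   AI_{ℚ(√5)}^ℚ(π_E) for E = ℰ_{81√5}, the Rubin–Silverberg mod-3 twist of 11a1 over K = ℚ(√5)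
--   (RubinSilverberg1995 Thm 4.1 with a = −27·496, b = −54·20008, t = 3⁴√5), A = Res_{K/ℚ}E: good
--   ordinary + 3-distinguished at 3 (reduction = 11a1 mod 3, #E(𝔽₉) = 15, a_(3) = −5), H¹(A) = Ind H¹(E)
--   irreducible (a_𝔭 ≠ ±a_𝔭σ at 71, 79, 89,

-- earlier Assembly (stmt-Langlands-12948, replaced 2026-08-15T19:29:53Z -> stmt-Langlands-13644): retired by None — SerreKWAutomorphicGL2 → StableYoshidaCongruence → ResiduallyYoshidaLifting → PhantomRMJunction → _root_.Langlands
/-- item stmt-Langlands-13644 · assembly · rank 1 · closed · proved by Summit.Langlands.Langlands.Theorems.PhantomRMYoshida.Assembly_proof @ e4adcf2dc632 (prover) · by planner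
sources: Thorne2014, BoxerCalegariGeePilloni2025, BuzzardGeeLMS2014
[assembly] SerreKWAutomorphicGL2 → StableYoshidaCongruence → ResiduallyYoshidaLifting →
PhantomRMJunction → Langlands (spelled `∀ _ : SerreKWAutomorphicGL2, …`, definitionally the arrow;
re-issued 2026-08-15 at the cone repair so that it prints after the restated decls; the deciding
theorem `closes` is unchanged). -/
@[route_item "route-Langlands-PhantomRMYoshida"]
def Assembly : Prop :=
  ∀ _ : SerreKWAutomorphicGL2, StableYoshidaCongruence → ResiduallyYoshidaLifting → PhantomRMJunction → _root_.Langlands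

/-! D-0027 §2.1 — DECIDING THEOREM (planner-authored via `route open/edit --closes-file`; by planner-rrepair-Langlands-PhantomRMYoshida-f172ac72-0 2026-08-15T19:29:53Z):
its hypotheses are this route's items and its conclusion the sub-problem Statement (glue_lint), and it elaborates with this file. -/

@[closes "route-Langlands-PhantomRMYoshida"] theorem closes (hKW : SerreKWAutomorphicGL2) (hS : StableYoshidaCongruence) (hL : ResiduallyYoshidaLifting) (hJ : PhantomRMJunction) : _root_.Langlands :=
  hJ (fun p _ hp k _ _ _ _ _ red σ σ' hcpt ι ρ hσ hσ' hirr hirr' hdet hnc hρirr hSh => (hS p hp k red σ σ' (hKW p k red σ hσ hirr) (hKW p k red σ' hσ' hirr') hirr hirr' hdet hnc ⟨ρ, hSh⟩ hcpt ι).elim fun ρ₀ h₀ => hL p hp k red σ σ' hcpt ι ρ₀ ρ hσ hσ' hirr hirr' hdet hnc h₀.1 h₀.2.1 h₀.2.2 hρirr hSh)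

end Summit.Langlands.Langlands.Theses.PhantomRMYoshida
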